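import Literature.Geometry.Riemannian.SharpLogSobolevAVR
import Literature.Geometry.Riemannian.BakryEmeryHeatFlow
import Literature.Geometry.Lorentzian.VolumeProofs
import Literature.Geometry.Lorentzian.VolumePositivity
import Literature.Analysis.FunctionSpaces.EuclideanLogSobolevLipschitz
import Literature.Analysis.FunctionSpaces.SymmetricDecreasingRearrangement
import Literature.Analysis.FunctionSpaces.EuclideanLogSobolevWeakGradient
import Literature.Analysis.FunctionSpaces.DiscretePolyaSzegoFour
import Literature.Geometry.Riemannian.IsoperimetricSlabInequality
import Literature.Geometry.Riemannian.CutLocusProofs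
import Literature.Geometry.Riemannian.SobolevLevelBound
import HarnessLib

/-!
# The sharp AVR log-Sobolev inequality: the printed form versus the scale family (reduction layer)

Companion of `SharpLogSobolevAVR.lean` (named fact `sharpLogSobolevAVR_four`: Balogh–Kristály–Tripaldi
2024, Thm. 1.1 with `p = 2`, `N = 4`, stated as the SCALE FAMILY
`∫ u² log u² ≤ 4τ ∫|∇u|² − log θ − 2 log(4πτ) − 4`, `τ > 0`). What is printed (J. Funct. Anal. 286
(2024) 110217 = arXiv:2210.15774, Thm. 1.1, p. 3, constants p. 2) is the LOGARITHMIC FORM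
`∫ u² log u² ≤ (N/p) log(𝓛_{p,N} AVR^{-p/N} ∫|∇u|^p)`, i.e. for `p = 2`, `N = 4`
(`𝓛_{2,4} = (2eπ)⁻¹`): `∫ u² log u² ≤ 2 log((2eπ)⁻¹ θ^{-1/2} ∫|∇u|²)`.
This file PROVES that the two renderings are equivalent on the data of the fact, so that the
tree's statement is exactly the printed theorem specialised to smooth complete `Ric ≥ 0`
four-manifolds:

* `logSobolev_scaleForm_of_logForm`, `logSobolev_logForm_of_scaleForm` — the one-variable
  identity behind the passage: for `G > 0`,
  `2 log((2eπ)⁻¹ θ^{-1/2} G) = min_{τ>0} (4τG − log θ − 2 log(4πτ) − 4)` (minimum at `τ = 1/(2G)`;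
  the inequality for every `τ` is `log x ≤ x − 1` at `x = 2τG`);
* `integral_gradSq_pos_of_avr` — **the Dirichlet energy of a normalised test function is positive**
  on the data of the fact: if closed distance balls about some point have volume ratio
  `vol{d(x,·) ≤ r}/(c rⁿ) → θ > 0` (`n ≥ 1`), then every smooth compactly supported `u` with
  `∫ u² dV = 1` has `∫ |∇u|² dV > 0` (otherwise `du = 0`, `u` is a non-zero constant on the connected
  manifold, which is then compact, of finite volume, and the volume ratio tends to `0`) — this is
  the remark "`∫|∇u|² = 0` is impossible" of the module docstring of `SharpLogSobolevAVR.lean`, and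
  the reason no side condition `∫|∇u|² > 0` is needed in either rendering;
* `sharpLogSobolevAVR_four_of_logForm` — **the printed form implies the fact**;
* `sharpLogSobolevAVR_four.logForm` — **the fact implies the printed form**;
* `logSobolev_scaleForm_of_rearrangement`, `sharpLogSobolevAVR_four_of_rearrangement` — **§3.1 of
  the paper as a theorem**: the fact follows from the existence, for every normalised test function
  `u`, of (approximate) Euclidean rearrangements `v ∈ C¹_c(ℝ⁴)` with `∫ v² dx = 1`, no smaller
  entropy and `∫ |∇v|² dx ≤ θ^{-1/2} ∫ |∇u|²_h dV_h` (the Pólya–Szegő inequality (2.4) of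
  Nobili–Violo with the invariance of norm and entropy, displays of §3.1) — the remaining analytic
  input, the sharp log-Sobolev inequality of the model space, being the PROVED
  `Literature.Analysis.FunctionSpaces.euclideanLogSobolev_scale_four`;
* `logSobolev_scaleForm_of_lipschitzRearrangement`,
  `sharpLogSobolevAVR_four_of_lipschitzRearrangement` — the same reduction fed with ONE compactly
  supported LIPSCHITZ rearrangement (no smoothing slack), through the Lipschitz form of the model
  inequality, `Literature.Analysis.FunctionSpaces.euclideanLogSobolev_scale_four_of_lipschitz`;
* `sharpLogSobolevAVR_four_of_polyaSzego` — **the residual content of the theorem**: with the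
  symmetric decreasing rearrangement `u♯ = symmDecRearr 4 dV_h |u|` of the tree
  (`SymmetricDecreasingRearrangement.lean`: compact support, `L²` norm and entropy of `u` are those
  of `u♯`, all proved), the fact follows from the Pólya–Szegő inequality (2.4) for `u♯` ALONE
  (`u♯` Lipschitz with `∫ ‖Du♯‖² dx ≤ θ^{-1/2} ∫ |∇u|²_h dV_h`) — pillars (a)+(c);
* `logSobolev_scaleForm_of_modelInequality`, `sharpLogSobolevAVR_four_of_sobolevRearrangement` —
  the same with the Pólya–Szegő inequality in the SOBOLEV form Nobili–Violo print (Adv. Math. 2024,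
  Prop. 3.3: `u♯ ∈ W^{1,2}` with `∫ ‖∇u♯‖² ≤ AVR^{-1/2} ∫ |∇u|²`), through the tree's weak-derivative
  vocabulary (`HasWeakFDerivOn`, `MemSobolevDomain`) and the proved
  `euclideanLogSobolev_scale_four_of_hasWeakFDerivOn`: the residual content of Thm. 1.1 relative to
  the tree is exactly that printed inequality (isoperimetry + coarea on manifolds);
* `logSobolev_scaleForm_of_approxLipschitzRearrangement`,
  `sharpLogSobolevAVR_four_of_approxLipschitzRearrangement` — the reduction fed with APPROXIMATE
  compactly supported Lipschitz rearrangements (`|∫ v² − 1| ≤ ε`, entropy and energy up to `ε`),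
  through the homogeneous Lipschitz model inequality
  `euclideanLogSobolev_scale_homogeneous_four_of_lipschitz` and `ε → 0`: the entrance for a
  discretised Pólya–Szegő argument that needs no Sobolev regularity of `u♯`.
* `sharpLogSobolevAVR_four_of_isoperimetric` — **the fact from the sharp isoperimetric inequality
  ALONE** (pillar (a): Balogh–Kristály, Math. Ann. 385 (2023), Thm. 1.1, in Minkowski-content form,
  `4 ω₄^{1/4} θ^{1/4} vol(Ω)^{3/4} ≤ liminf_{ε→0⁺} vol(Ω_ε ∖ Ω)/ε` for bounded Borel `Ω`; on manifolds
  Brendle, CPAM 76 (2023), Thm. 1.1): pillar (c) is replaced by the tree's PROVED slab inequality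
  without coarea (`IsoperimetricSlabInequality.lean`) and discretised Pólya–Szegő inequality
  (`DiscretePolyaSzegoFour.lean`), pillar (b) by the proved Lipschitz Euclidean log-Sobolev inequality.
* `sharpLogSobolevAVR_four_of_levelBound` — the common core: the fact from the **level bound**
  `4 ω₄^{1/4} θ^{1/4} vol{|u| ≥ t₂}^{3/4} (t₂ − t₁) ≤ ∫_{t₁<|u|<t₂} |∇u|` for test functions, the weakest
  form in which isoperimetry is used; `levelBound_of_slab` passes from the slab inequality to it;
* `sharpLogSobolevAVR_four_of_l1Sobolev` — **the fact from the sharp `L¹`-Sobolev inequality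
  ALONE** (Brendle, CPAM 76 (2023), Thm. 1.1, for `C_c^∞` functions: `4 ω₄^{1/4} θ^{1/4} ‖φ‖_{4/3}
  ≤ ∫ |∇φ|`), through `SobolevLevelBound.lean` (smooth truncations; no coarea formula, no Minkowski
  content, no level-set regularity): the form of pillar (a) an ABP proof delivers.

Everything is proved; no definitions, no named facts (D-0026). What is NOT here: the theorem
itself (`sharpLogSobolevAVR_four_holds`). Its printed proof (§3.1 of the paper) needs (a) the sharp
isoperimetric inequality of `CD(0,N)` spaces / `Ric ≥ 0` manifolds with Euclidean volume growth
(Balogh–Kristály; Brendle; Agostiniani–Fogagnolo–Mazzieri), (b) the sharp weighted log-Sobolev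
inequality on the model half-line `([0,∞), N σ_N r^{N-1} dr)` (Balogh–Don–Kristály) — the radial
case of the sharp Euclidean log-Sobolev inequality, which the tree HAS
(`Literature/Analysis/FunctionSpaces/EuclideanLogSobolev.lean`) — and (c) the Pólya–Szegő inequality
by rearrangement and the coarea formula (Nobili–Violo); (a) and (c) are neither in Mathlib nor in
the tree at the time of writing, and `sharpLogSobolevAVR_four_of_rearrangement` is exactly what they
must be fed into.

## References

* [BaloghKristalyTripaldi2024] Z. M. Balogh, A. Kristály, F. Tripaldi, *Sharp log-Sobolev
  inequalities in `CD(0,N)` spaces with applications*, J. Funct. Anal. 286 (2024) 110217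
  (arXiv:2210.15774): Thm. 1.1 (p. 3), constants `𝓛_{p,N}`, `σ_N` (p. 2), §3.1 (proof). READ.
-/

noncomputable section

open Bundle Set Function Filter MeasureTheory Manifold
open scoped ContDiff Topology ENNReal NNReal

namespace Literature.Geometry.Riemannian

open Lorentzian Lorentzian.PseudoRiemannianMetric

/-! ### The one-variable passage between the logarithmic form and the scale family -/

/-- `log (2eπ)⁻¹ = -log 2 - 1 - log π`. [folklore] -/
private theorem log_inv_two_e_pi :
    Real.log ((2 * Real.exp 1 * Real.pi)⁻¹) = -Real.log 2 - 1 - Real.log Real.pi := by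
  rw [Real.log_inv, Real.log_mul (by positivity) Real.pi_pos.ne',
    Real.log_mul (by norm_num) (Real.exp_pos 1).ne', Real.log_exp]
  ring

/-- The printed right-hand side unfolded: for `θ, G > 0`,
`2 log((2eπ)⁻¹ θ^{-1/2} G) = -2 log 2 - 2 - 2 log π - log θ + 2 log G`. [folklore] -/
private theorem two_mul_log_printed_eq {θ G : ℝ} (hθ : 0 < θ) (hG : 0 < G) :
    2 * Real.log ((2 * Real.exp 1 * Real.pi)⁻¹ * θ ^ (-(1 : ℝ) / 2) * G) =
      -2 * Real.log 2 - 2 - 2 * Real.log Real.pi - Real.log θ + 2 * Real.log G := by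
  have h1 : (0 : ℝ) < (2 * Real.exp 1 * Real.pi)⁻¹ := by positivity
  have h2 : (0 : ℝ) < θ ^ (-(1 : ℝ) / 2) := Real.rpow_pos_of_pos hθ _
  rw [Real.log_mul (mul_pos h1 h2).ne' hG.ne', Real.log_mul h1.ne' h2.ne', log_inv_two_e_pi,
    Real.log_rpow hθ]
  ring

/-- **Logarithmic form ⇒ scale family.** If `E ≤ 2 log((2eπ)⁻¹ θ^{-1/2} G)` with `θ, G > 0`, then
for every `τ > 0`, `E ≤ 4τG − log θ − 2 log(4πτ) − 4`: after unfolding the logarithms this is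
`log(2τG) + 1 ≤ 2τG`, i.e. `log x ≤ x − 1` (Balogh–Kristály–Tripaldi 2024, Thm. 1.1, combined with
`2 log Y = min_{A>0}(2Y/A − 2 + 2 log A)`; see the module docstring of `SharpLogSobolevAVR.lean`).
[cite: BaloghKristalyTripaldi2024, Thm. 1.1 (p. 3)] -/
theorem logSobolev_scaleForm_of_logForm {E G θ τ : ℝ} (hθ : 0 < θ) (hτ : 0 < τ) (hG : 0 < G)
    (hE : E ≤ 2 * Real.log ((2 * Real.exp 1 * Real.pi)⁻¹ * θ ^ (-(1 : ℝ) / 2) * G)) :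
    E ≤ 4 * τ * G - Real.log θ - 2 * Real.log (4 * Real.pi * τ) - 4 := by
  rw [two_mul_log_printed_eq hθ hG] at hE
  have h4 : Real.log (4 * Real.pi * τ) = 2 * Real.log 2 + Real.log Real.pi + Real.log τ := by
    rw [Real.log_mul (by positivity) hτ.ne', Real.log_mul (by norm_num) Real.pi_pos.ne',
      show (4 : ℝ) = 2 ^ 2 by norm_num, Real.log_pow]
    push_cast
    ring
  have hx : Real.log (2 * τ * G) ≤ 2 * τ * G - 1 := Real.log_le_sub_one_of_pos (by positivity)
  rw [Real.log_mul (by positivity) hG.ne', Real.log_mul (by norm_num) hτ.ne'] at hx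
  rw [h4]
  linarith

/-- **Scale family ⇒ logarithmic form.** If `E ≤ 4τG − log θ − 2 log(4πτ) − 4` for every `τ > 0`,
with `θ, G > 0`, then `E ≤ 2 log((2eπ)⁻¹ θ^{-1/2} G)` (take `τ = 1/(2G)`, where the scale family
attains its minimum, equal to the printed right-hand side).
[cite: BaloghKristalyTripaldi2024, Thm. 1.1 (p. 3)] -/
theorem logSobolev_logForm_of_scaleForm {E G θ : ℝ} (hθ : 0 < θ) (hG : 0 < G)
    (hE : ∀ τ : ℝ, 0 < τ → E ≤ 4 * τ * G - Real.log θ - 2 * Real.log (4 * Real.pi * τ) - 4) :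
    E ≤ 2 * Real.log ((2 * Real.exp 1 * Real.pi)⁻¹ * θ ^ (-(1 : ℝ) / 2) * G) := by
  have h := hE (1 / (2 * G)) (by positivity)
  rw [two_mul_log_printed_eq hθ hG]
  have h4 : Real.log (4 * Real.pi * (1 / (2 * G))) = Real.log 2 + Real.log Real.pi - Real.log G := by
    rw [show 4 * Real.pi * (1 / (2 * G)) = 2 * Real.pi / G by field_simp; ring,
      Real.log_div (by positivity) hG.ne', Real.log_mul (by norm_num) Real.pi_pos.ne']
  rw [h4, show 4 * (1 / (2 * G)) * G = 2 by field_simp; ring] at h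
  linarith

/-! ### A function with vanishing differential on a connected manifold is constant -/

section Constancy

variable {E : Type*} [NormedAddCommGroup E] [NormedSpace ℝ E] {H : Type*} [TopologicalSpace H]
  {I : ModelWithCorners ℝ E H} [I.Boundaryless] {M : Type*} [TopologicalSpace M]
  [ChartedSpace H M] [IsManifold I ∞ M]

/-- **A `C¹` function with identically vanishing differential on a connected manifold is
constant** (in a chart this is the mean value theorem on a ball,
`Convex.is_const_of_fderivWithin_eq_zero`; then connectedness,
`IsLocallyConstant.apply_eq_of_preconnectedSpace`). O'Neill 1983, Ch. 1, Exercise 12 (b); the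
proof is that of `apply_eq_apply_of_mfderiv_eq_zero` in `ShrinkerSplittingAtInfinityProofs.lean`,
repeated here to keep the imports of this file small. [folklore] -/
private theorem apply_eq_apply_of_mfderiv_eq_zero_aux [ConnectedSpace M] {f : M → ℝ}
    (hf : ContMDiff I 𝓘(ℝ, ℝ) 1 f) (h0 : ∀ x, mfderiv I 𝓘(ℝ, ℝ) f x = 0) (x y : M) :
    f x = f y := by
  suffices hloc : IsLocallyConstant f from hloc.apply_eq_of_preconnectedSpace x y
  refine (IsLocallyConstant.iff_eventually_eq f).2 fun x₀ ↦ ?_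
  set φ := extChartAt I x₀ with hφ
  set F : E → ℝ := f ∘ φ.symm with hF
  -- `F` is differentiable with zero derivative on the (open) chart target
  have hFd : ∀ z ∈ φ.target, DifferentiableAt ℝ F z ∧ fderiv ℝ F z = 0 := by
    intro z hz
    have h1 : MDifferentiableAt 𝓘(ℝ, E) I φ.symm z := by
      have := mdifferentiableWithinAt_extChartAt_symm hz
      rwa [ModelWithCorners.Boundaryless.range_eq_univ, mdifferentiableWithinAt_univ] at this
    have h2 : MDifferentiableAt I 𝓘(ℝ, ℝ) f (φ.symm z) := (hf _).mdifferentiableAt one_ne_zero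
    have h3 : MDifferentiableAt 𝓘(ℝ, E) 𝓘(ℝ, ℝ) F z := h2.comp z h1
    have h4 : mfderiv 𝓘(ℝ, E) 𝓘(ℝ, ℝ) F z = 0 := by
      rw [hF, mfderiv_comp z h2 h1, h0]
      exact ContinuousLinearMap.zero_comp _
    refine ⟨mdifferentiableAt_iff_differentiableAt.1 h3, ?_⟩
    rwa [mfderiv_eq_fderiv] at h4
  -- a ball inside the target around `φ x₀`
  obtain ⟨r, hr, hball⟩ := Metric.mem_nhds_iff.1 (extChartAt_target_mem_nhds (I := I) x₀)
  have hconst : ∀ z ∈ Metric.ball (φ x₀) r, F z = F (φ x₀) := by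
    intro z hz
    refine (convex_ball (φ x₀) r).is_const_of_fderivWithin_eq_zero (𝕜 := ℝ)
      (fun w hw ↦ (hFd w (hball hw)).1.differentiableWithinAt) ?_ hz (Metric.mem_ball_self hr)
    intro w hw
    rw [fderivWithin_of_isOpen Metric.isOpen_ball hw]
    exact (hFd w (hball hw)).2
  -- pull back to the manifold
  have hsrc : ∀ᶠ y in 𝓝 x₀, y ∈ φ.source := extChartAt_source_mem_nhds (I := I) x₀
  have hpre : ∀ᶠ y in 𝓝 x₀, φ y ∈ Metric.ball (φ x₀) r :=
    (continuousAt_extChartAt (I := I) x₀).preimage_mem_nhds (Metric.ball_mem_nhds _ hr)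
  filter_upwards [hsrc, hpre] with y hy hyb
  have e1 : f y = F (φ y) := by
    simp only [hF, Function.comp_apply, φ.left_inv hy]
  have e2 : f x₀ = F (φ x₀) := by
    simp only [hF, Function.comp_apply, φ.left_inv (mem_extChartAt_source (I := I) x₀)]
  rw [e1, e2, hconst _ hyb]

end Constancy

/-! ### Pointwise facts on `|∇u|²_h` for a Riemannian `h` -/

section Pointwise

variable {n : ℕ} {P : Type*} [TopologicalSpace P] [ChartedSpace (EuclideanSpace ℝ (Fin n)) P]
  [IsManifold (𝓡 n) ∞ P]
  (h : PseudoRiemannianMetric (𝓡 n) ∞ (EuclideanSpace ℝ (Fin n)) (TangentSpace (𝓡 n) : P → Type _))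

/-- `|∇u|²_h = h(♯du, ♯du) ≥ 0` for a Riemannian `h` — deprecated alias of
`PseudoRiemannianMetric.gradSq_nonneg` (`PerelmanEntropyCutoff.lean`, imported through
`BakryEmeryHeatFlow`), which the proof below uses by dot notation (librarian dedup-02656).
[folklore] -/
@[deprecated PseudoRiemannianMetric.gradSq_nonneg (since := "2026-08-17")]
alias gradSq_nonneg_of_isRiemannian' := PseudoRiemannianMetric.gradSq_nonneg

/-- **`|∇u|²_h(x) = 0` forces `du_x = 0`** for a Riemannian `h` (`|∇u|² = h(♯du, ♯du)` with `h_x`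
positive definite, and `♭ ∘ ♯ = id`). [folklore] -/
theorem mfderiv_eq_zero_of_gradSq_eq_zero (hh : h.IsRiemannian) {u : P → ℝ} {x : P}
    (h0 : h.gradSq u x = 0) : mfderiv (𝓡 n) 𝓘(ℝ, ℝ) u x = 0 := by
  set α : TangentSpace (𝓡 n) x →ₗ[ℝ] ℝ :=
    (mvfderiv (𝓡 n) u x : TangentSpace (𝓡 n) x →ₗ[ℝ] ℝ) with hα
  have hgrad : h.gradSq u x = h.val x (h.sharp x α) (h.sharp x α) := by
    rw [PseudoRiemannianMetric.gradSq, innerDual_eq_val_sharp_sharp]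
  have hs : h.sharp x α = 0 := by
    by_contra hne
    have hpos := hh x _ hne
    rw [← hgrad, h0] at hpos
    exact lt_irrefl _ hpos
  have hα0 : α = 0 := by
    have e := h.flat_sharp x α
    rw [hs, map_zero] at e
    exact e.symm
  ext v
  have hv : (mvfderiv (𝓡 n) u x : TangentSpace (𝓡 n) x →ₗ[ℝ] ℝ) v = 0 := by
    rw [← hα, hα0, LinearMap.zero_apply]
  simpa [mvfderiv] using hv

/-- `|∇u|²_h` vanishes off the topological support of `u`. [folklore] -/
theorem gradSq_eq_zero_of_notMem_tsupport' {u : P → ℝ} {x : P} (hx : x ∉ tsupport u) :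
    h.gradSq u x = 0 := by
  have hu : u =ᶠ[𝓝 x] fun _ ↦ (0 : ℝ) := notMem_tsupport_iff_eventuallyEq.1 hx
  have h1 : mfderiv (𝓡 n) 𝓘(ℝ, ℝ) u x = 0 := by
    rw [hu.mfderiv_eq]
    exact mfderiv_const
  have hd : mvfderiv (𝓡 n) u x = 0 := by
    simp only [mvfderiv, h1, ContinuousLinearMap.comp_zero]
  simp [PseudoRiemannianMetric.gradSq, PseudoRiemannianMetric.innerDual, hd]

end Pointwise

/-! ### Positivity of the Dirichlet energy on the data of the fact -/

section Energy

variable {n : ℕ} {P : Type*} [TopologicalSpace P] [ChartedSpace (EuclideanSpace ℝ (Fin n)) P]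
  [IsManifold (𝓡 n) ∞ P] [T3Space P] [MeasurableSpace P] [BorelSpace P] [ConnectedSpace P]
  (h : PseudoRiemannianMetric (𝓡 n) ∞ (EuclideanSpace ℝ (Fin n)) (TangentSpace (𝓡 n) : P → Type _))

/-- **The Dirichlet energy of a normalised test function is positive under Euclidean volume
growth.** On a connected `n`-manifold, `n ≥ 1`, with a smooth Riemannian metric `h` whose closed
distance balls about some point `x₀` satisfy `vol{d(x₀,·) ≤ r}/(c rⁿ) → θ` as `r → ∞` with
`c, θ > 0`, every smooth compactly supported `u` with `∫ u² dV_h = 1` has `0 < ∫ |∇u|²_h dV_h`.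
Indeed `∫|∇u|² = 0` forces `|∇u|² ≡ 0` (a continuous non-negative integrand; the Riemannian measure
charges open sets), hence `du ≡ 0`, so `u` is a constant `≠ 0` on the connected manifold, which is
then compact (`u` has compact support), of finite volume, and the volume ratio tends to `0 < θ`.
This is why neither rendering of Balogh–Kristály–Tripaldi's Thm. 1.1 needs the side condition
`∫|∇u|² > 0` (see the module docstring of `SharpLogSobolevAVR.lean`). [folklore] -/
theorem integral_gradSq_pos_of_avr (hh : h.IsRiemannian) (hn : n ≠ 0) {c θ : ℝ} (hc : 0 < c)
    (hθ : 0 < θ) {x₀ : P}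
    (havr : Tendsto (fun r : ℝ ↦ ((riemannianMeasure (h.toContMDiffRiemannianMetric hh))
        {y : P | h.edist hh x₀ y ≤ ENNReal.ofReal r}).toReal / (c * r ^ n)) atTop (𝓝 θ))
    {u : P → ℝ} (hu : ContMDiff (𝓡 n) 𝓘(ℝ, ℝ) ∞ u) (hcu : HasCompactSupport u)
    (h1 : ∫ x, u x ^ 2 ∂(riemannianMeasure (h.toContMDiffRiemannianMetric hh)) = 1) :
    0 < ∫ x, h.gradSq u x ∂(riemannianMeasure (h.toContMDiffRiemannianMetric hh)) := by
  set μ : Measure P := riemannianMeasure (h.toContMDiffRiemannianMetric hh) with hμ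
  haveI : μ.IsOpenPosMeasure := isOpenPosMeasure_riemannianMeasure _
  haveI : IsFiniteMeasureOnCompacts μ :=
    ⟨fun K hK ↦ riemannianVolume_lt_top_of_isCompact_holds _ le_rfl hK⟩
  have hgc : Continuous (h.gradSq u) := (contMDiff_gradSq h hu).continuous
  have hg0 : ∀ x, 0 ≤ h.gradSq u x := h.gradSq_nonneg hh u
  have hgsupp : HasCompactSupport (h.gradSq u) := by
    refine hcu.mono' fun x hx ↦ ?_
    by_contra hx'
    exact hx (gradSq_eq_zero_of_notMem_tsupport' h hx')
  have hgi : Integrable (h.gradSq u) μ := hgc.integrable_of_hasCompactSupport hgsupp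
  by_contra hle
  push Not at hle
  have hG0 : ∫ x, h.gradSq u x ∂μ = 0 := le_antisymm hle (integral_nonneg hg0)
  have hae : h.gradSq u =ᵐ[μ] 0 := (integral_eq_zero_iff_of_nonneg hg0 hgi).1 hG0
  have hzero : h.gradSq u = 0 := Measure.eq_of_ae_eq hae hgc continuous_const
  -- `du = 0` everywhere, so `u` is constant
  have hd : ∀ x, mfderiv (𝓡 n) 𝓘(ℝ, ℝ) u x = 0 := fun x ↦
    mfderiv_eq_zero_of_gradSq_eq_zero h hh (congr_fun hzero x)
  have hconst : ∀ x, u x = u x₀ := fun x ↦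
    apply_eq_apply_of_mfderiv_eq_zero_aux (hu.of_le (by exact_mod_cast le_top)) hd x x₀
  by_cases hc0 : u x₀ = 0
  · -- `u ≡ 0` contradicts `∫ u² = 1`
    have hu0 : u = fun _ ↦ 0 := funext fun x ↦ (hconst x).trans hc0
    rw [hu0] at h1
    simp at h1
  · -- `u` is a non-zero constant with compact support: the manifold is compact
    have hsupp : tsupport u = univ := by
      refine eq_univ_iff_forall.2 fun x ↦ subset_tsupport u ?_
      rw [mem_support, hconst x]
      exact hc0
    have hK : IsCompact (univ : Set P) := by rw [← hsupp]; exact hcu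
    have hfin : μ univ < ⊤ := riemannianVolume_lt_top_of_isCompact_holds _ le_rfl hK
    have hbound : ∀ᶠ r in atTop,
        (μ {y : P | h.edist hh x₀ y ≤ ENNReal.ofReal r}).toReal / (c * r ^ n) ≤
          (μ univ).toReal / (c * r ^ n) := by
      filter_upwards [eventually_gt_atTop 0] with r hr
      exact div_le_div_of_nonneg_right
        (ENNReal.toReal_mono hfin.ne (measure_mono (subset_univ _))) (by positivity)
    have hlim : Tendsto (fun r : ℝ ↦ (μ univ).toReal / (c * r ^ n)) atTop (𝓝 0) :=
      tendsto_const_nhds.div_atTop ((tendsto_pow_atTop hn).const_mul_atTop hc)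
    have hθle : θ ≤ 0 := le_of_tendsto_of_tendsto havr hlim hbound
    exact absurd hθle (not_le.2 hθ)

end Energy

/-! ### The two renderings of Thm. 1.1 (`p = 2`, `N = 4`) are equivalent -/

/-- **The printed form implies the fact.** If, on the data of `sharpLogSobolevAVR_four` (a
connected four-manifold with a complete smooth Riemannian `h`, `Ric_h ≥ 0`, asymptotic volume
ratio `θ > 0`), every smooth compactly supported `u` with `∫ u² dV_h = 1` satisfies the inequality
AS PRINTED in Balogh–Kristály–Tripaldi 2024, Thm. 1.1 (`p = 2`, `N = 4`, `𝓛_{2,4} = (2eπ)⁻¹`):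
`∫ u² log u² dV_h ≤ 2 log((2eπ)⁻¹ θ^{-1/2} ∫ |∇u|²_h dV_h)`, then `sharpLogSobolevAVR_four` holds
(`logSobolev_scaleForm_of_logForm`, the energy being positive by `integral_gradSq_pos_of_avr`).
[cite: BaloghKristalyTripaldi2024, Thm. 1.1 (p. 3)] -/
theorem sharpLogSobolevAVR_four_of_logForm
    (H : ∀ (P : Type) [TopologicalSpace P] [T2Space P] [SecondCountableTopology P]
      [ChartedSpace (EuclideanSpace ℝ (Fin 4)) P] [IsManifold (𝓡 4) ∞ P] [ConnectedSpace P]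
      [T3Space P] [MeasurableSpace P] [BorelSpace P]
      (h : PseudoRiemannianMetric (𝓡 4) ∞ (EuclideanSpace ℝ (Fin 4)) (TangentSpace (𝓡 4) : P → Type _))
      [h.HasLeviCivita] (hh : h.IsRiemannian) (θ : ℝ),
      (∀ (x : P) (r : NNReal), IsCompact {y : P | h.edist hh x y ≤ r}) →
      (∀ (x : P) (X : TangentSpace (𝓡 4) x), 0 ≤ h.ricci x X X) → 0 < θ →
      (∀ x : P, Tendsto (fun r : ℝ ↦
        ((riemannianMeasure (h.toContMDiffRiemannianMetric hh))
          {y : P | h.edist hh x y ≤ ENNReal.ofReal r}).toReal / (Real.pi ^ 2 / 2 * r ^ 4))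
        atTop (𝓝 θ)) →
      ∀ u : P → ℝ, ContMDiff (𝓡 4) 𝓘(ℝ, ℝ) ∞ u → HasCompactSupport u →
        ∫ x, (u x) ^ 2 ∂(riemannianMeasure (h.toContMDiffRiemannianMetric hh)) = 1 →
          ∫ x, (u x) ^ 2 * Real.log ((u x) ^ 2) ∂(riemannianMeasure (h.toContMDiffRiemannianMetric hh)) ≤
            2 * Real.log ((2 * Real.exp 1 * Real.pi)⁻¹ * θ ^ (-(1 : ℝ) / 2) *
              ∫ x, h.gradSq u x ∂(riemannianMeasure (h.toContMDiffRiemannianMetric hh)))) :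
    sharpLogSobolevAVR_four := by
  intro P _ _ _ _ _ _ _ _ _ h _ hh θ hcpt hRic hθ havr u hu hcu h1 τ hτ
  haveI : Nonempty P := ConnectedSpace.toNonempty
  obtain ⟨x₀⟩ := ‹Nonempty P›
  have hG : 0 < ∫ x, h.gradSq u x ∂(riemannianMeasure (h.toContMDiffRiemannianMetric hh)) :=
    integral_gradSq_pos_of_avr h hh four_ne_zero (by positivity) hθ (havr x₀) hu hcu h1
  exact logSobolev_scaleForm_of_logForm hθ hτ hG (H P h hh θ hcpt hRic hθ havr u hu hcu h1)

/-- **The fact implies the printed form.** From `sharpLogSobolevAVR_four`, on its data every smooth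
compactly supported `u` with `∫ u² dV_h = 1` satisfies Balogh–Kristály–Tripaldi's Thm. 1.1 as
printed (`p = 2`, `N = 4`): `∫ u² log u² dV_h ≤ 2 log((2eπ)⁻¹ θ^{-1/2} ∫ |∇u|²_h dV_h)`
(`logSobolev_logForm_of_scaleForm` at `τ = 1/(2∫|∇u|²)`, the energy being positive by
`integral_gradSq_pos_of_avr`). [cite: BaloghKristalyTripaldi2024, Thm. 1.1 (p. 3)] -/
theorem sharpLogSobolevAVR_four.logForm (hfact : sharpLogSobolevAVR_four)
    (P : Type) [TopologicalSpace P] [T2Space P] [SecondCountableTopology P]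
    [ChartedSpace (EuclideanSpace ℝ (Fin 4)) P] [IsManifold (𝓡 4) ∞ P] [ConnectedSpace P]
    [T3Space P] [MeasurableSpace P] [BorelSpace P]
    (h : PseudoRiemannianMetric (𝓡 4) ∞ (EuclideanSpace ℝ (Fin 4)) (TangentSpace (𝓡 4) : P → Type _))
    [h.HasLeviCivita] (hh : h.IsRiemannian) (θ : ℝ)
    (hcpt : ∀ (x : P) (r : NNReal), IsCompact {y : P | h.edist hh x y ≤ r})
    (hRic : ∀ (x : P) (X : TangentSpace (𝓡 4) x), 0 ≤ h.ricci x X X) (hθ : 0 < θ)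
    (havr : ∀ x : P, Tendsto (fun r : ℝ ↦
      ((riemannianMeasure (h.toContMDiffRiemannianMetric hh))
        {y : P | h.edist hh x y ≤ ENNReal.ofReal r}).toReal / (Real.pi ^ 2 / 2 * r ^ 4))
      atTop (𝓝 θ))
    (u : P → ℝ) (hu : ContMDiff (𝓡 4) 𝓘(ℝ, ℝ) ∞ u) (hcu : HasCompactSupport u)
    (h1 : ∫ x, (u x) ^ 2 ∂(riemannianMeasure (h.toContMDiffRiemannianMetric hh)) = 1) :
    ∫ x, (u x) ^ 2 * Real.log ((u x) ^ 2) ∂(riemannianMeasure (h.toContMDiffRiemannianMetric hh)) ≤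
      2 * Real.log ((2 * Real.exp 1 * Real.pi)⁻¹ * θ ^ (-(1 : ℝ) / 2) *
        ∫ x, h.gradSq u x ∂(riemannianMeasure (h.toContMDiffRiemannianMetric hh))) := by
  haveI : Nonempty P := ConnectedSpace.toNonempty
  obtain ⟨x₀⟩ := ‹Nonempty P›
  have hG : 0 < ∫ x, h.gradSq u x ∂(riemannianMeasure (h.toContMDiffRiemannianMetric hh)) :=
    integral_gradSq_pos_of_avr h hh four_ne_zero (by positivity) hθ (havr x₀) hu hcu h1
  exact logSobolev_logForm_of_scaleForm hθ hG
    fun τ hτ ↦ hfact P h hh θ hcpt hRic hθ havr u hu hcu h1 τ hτ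

/-! ### §3.1 of the paper: reduction to a Pólya–Szegő rearrangement -/

/-- **The real-variable heart of §3.1.** Let `θ > 0` and let `E`, `G` be two reals (the entropy
`∫ u² log u² dV_h` and the energy `∫ |∇u|²_h dV_h` of a normalised test function). Suppose that for
every `ε > 0` there is a `C¹` compactly supported `v : ℝ⁴ → ℝ` with `∫ v² dx = 1`, entropy at least
`E − ε` and Euclidean energy `∫ |∇v|² dx ≤ θ^{-1/2} G + ε` (what the rearrangement `û ∘ |·|` of
Balogh–Kristály–Tripaldi 2024, §2.1–§3.1 provides, up to smoothing: norm and entropy are invariant,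
displays of §3.1, and `∫ |∇u|² dm ≥ AVR^{1/2} ∫ |û′|² dω` is the Pólya–Szegő inequality (2.4) of
Nobili–Violo with `p = 2`, `N = 4`, `ω = 4σ₄ r³ dr` the polar measure of `ℝ⁴`). Then the scale family
of the fact holds: `E ≤ 4τG − log θ − 2 log(4πτ) − 4` for every `τ > 0` — by the sharp Euclidean
log-Sobolev inequality `euclideanLogSobolev_scale_four` at the scale `σ = τ θ^{1/2}` and `ε → 0`.
[cite: BaloghKristalyTripaldi2024, §3.1 (p. 8) with (2.4), (2.5)] -/
theorem logSobolev_scaleForm_of_rearrangement {E G θ : ℝ} (hθ : 0 < θ)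
    (H : ∀ ε : ℝ, 0 < ε → ∃ v : EuclideanSpace ℝ (Fin 4) → ℝ, ContDiff ℝ 1 v ∧ HasCompactSupport v ∧
      (∫ x, v x ^ 2) = 1 ∧ E ≤ (∫ x, v x ^ 2 * Real.log (v x ^ 2)) + ε ∧
      (∫ x, ‖fderiv ℝ v x‖ ^ 2) ≤ θ ^ (-(1 : ℝ) / 2) * G + ε)
    {τ : ℝ} (hτ : 0 < τ) :
    E ≤ 4 * τ * G - Real.log θ - 2 * Real.log (4 * Real.pi * τ) - 4 := by
  refine le_of_forall_pos_le_add fun δ hδ ↦ ?_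
  have hsq : 0 < Real.sqrt θ := Real.sqrt_pos.2 hθ
  obtain ⟨σ, hσ⟩ : ∃ σ : ℝ, σ = τ * Real.sqrt θ := ⟨_, rfl⟩
  have hσpos : 0 < σ := hσ ▸ mul_pos hτ hsq
  obtain ⟨d, hd⟩ : ∃ d : ℝ, d = δ / (1 + 4 * σ) := ⟨_, rfl⟩
  have hdpos : 0 < d := hd ▸ div_pos hδ (by positivity)
  obtain ⟨v, hv, hvs, hv1, hvE, hvG⟩ := H d hdpos
  have hLSI := Literature.Analysis.FunctionSpaces.euclideanLogSobolev_scale_four hv hvs hv1 hσpos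
  have hkey : σ * θ ^ (-(1 : ℝ) / 2) = τ := by
    rw [hσ, neg_div, Real.rpow_neg hθ.le, ← Real.sqrt_eq_rpow, mul_assoc, mul_inv_cancel₀ hsq.ne',
      mul_one]
  have hlog : Real.log (4 * Real.pi * σ) = Real.log (4 * Real.pi * τ) + Real.log θ / 2 := by
    rw [hσ, ← mul_assoc, Real.log_mul (by positivity) hsq.ne', Real.log_sqrt hθ.le]
  have h5 : 4 * σ * d + d = δ := by
    rw [hd]
    field_simp
    ring
  -- (the energy integral of `hLSI` is matched against that of `hvG` by unification, not by
  -- `linarith`, whose atoms are syntactic)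
  have h6 : 4 * σ * (∫ x, ‖fderiv ℝ v x‖ ^ 2) ≤ 4 * σ * (θ ^ (-(1 : ℝ) / 2) * G + d) :=
    mul_le_mul_of_nonneg_left hvG (by positivity)
  have h7 := hLSI.trans (sub_le_sub_right (sub_le_sub_right h6 (2 * Real.log (4 * Real.pi * σ))) 4)
  have h8 : 4 * σ * (θ ^ (-(1 : ℝ) / 2) * G + d) = 4 * τ * G + 4 * σ * d := by
    calc 4 * σ * (θ ^ (-(1 : ℝ) / 2) * G + d) = 4 * (σ * θ ^ (-(1 : ℝ) / 2)) * G + 4 * σ * d := by ring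
      _ = 4 * τ * G + 4 * σ * d := by rw [hkey]
  rw [h8, hlog] at h7
  have h9 := hvE.trans (add_le_add h7 (le_refl d))
  linarith [h9, h5]

/-- **§3.1 of Balogh–Kristály–Tripaldi 2024 as a theorem: `sharpLogSobolevAVR_four` follows from a
Pólya–Szegő rearrangement.** If on the data of the fact (a connected four-manifold, complete smooth
Riemannian `h`, `Ric_h ≥ 0`, asymptotic volume ratio `θ > 0`) every smooth compactly supported `u`
with `∫ u² dV_h = 1` admits, for every `ε > 0`, a `C¹` compactly supported `v : ℝ⁴ → ℝ` with
`∫ v² dx = 1`, `∫ u² log u² dV_h ≤ ∫ v² log v² dx + ε` and `∫ |∇v|² dx ≤ θ^{-1/2} ∫ |∇u|²_h dV_h + ε`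
— the invariance of norm and entropy under the rearrangement `u ↦ û` and the Pólya–Szegő inequality
(2.4) (`∫_X |∇u|² dm ≥ AVR^{1/2} · 4σ₄ ∫₀^∞ |û′|² r³ dr`, Nobili–Violo, from the sharp isoperimetric
inequality of `CD(0,4)` spaces and the coarea formula), read on `ℝ⁴ ∋ x ↦ û(|x|)` with an `ε` of room
for smoothing the Lipschitz function `û` — then the fact holds, the model-space log-Sobolev inequality
(2.5) being supplied by the proved `euclideanLogSobolev_scale_four`. This isolates exactly the
geometric input ((a) isoperimetry, (c) rearrangement/coarea) that a proof of
`sharpLogSobolevAVR_four_holds` still has to provide.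
[cite: BaloghKristalyTripaldi2024, §3.1 (p. 8), (2.4), (2.5)] -/
theorem sharpLogSobolevAVR_four_of_rearrangement
    (H : ∀ (P : Type) [TopologicalSpace P] [T2Space P] [SecondCountableTopology P]
      [ChartedSpace (EuclideanSpace ℝ (Fin 4)) P] [IsManifold (𝓡 4) ∞ P] [ConnectedSpace P]
      [T3Space P] [MeasurableSpace P] [BorelSpace P]
      (h : PseudoRiemannianMetric (𝓡 4) ∞ (EuclideanSpace ℝ (Fin 4)) (TangentSpace (𝓡 4) : P → Type _))
      [h.HasLeviCivita] (hh : h.IsRiemannian) (θ : ℝ),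
      (∀ (x : P) (r : NNReal), IsCompact {y : P | h.edist hh x y ≤ r}) →
      (∀ (x : P) (X : TangentSpace (𝓡 4) x), 0 ≤ h.ricci x X X) → 0 < θ →
      (∀ x : P, Tendsto (fun r : ℝ ↦
        ((riemannianMeasure (h.toContMDiffRiemannianMetric hh))
          {y : P | h.edist hh x y ≤ ENNReal.ofReal r}).toReal / (Real.pi ^ 2 / 2 * r ^ 4))
        atTop (𝓝 θ)) →
      ∀ u : P → ℝ, ContMDiff (𝓡 4) 𝓘(ℝ, ℝ) ∞ u → HasCompactSupport u →
        ∫ x, (u x) ^ 2 ∂(riemannianMeasure (h.toContMDiffRiemannianMetric hh)) = 1 →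
        ∀ ε : ℝ, 0 < ε → ∃ v : EuclideanSpace ℝ (Fin 4) → ℝ, ContDiff ℝ 1 v ∧ HasCompactSupport v ∧
          (∫ x, v x ^ 2) = 1 ∧
          (∫ x, (u x) ^ 2 * Real.log ((u x) ^ 2) ∂(riemannianMeasure (h.toContMDiffRiemannianMetric hh))) ≤
            (∫ x, v x ^ 2 * Real.log (v x ^ 2)) + ε ∧
          (∫ x, ‖fderiv ℝ v x‖ ^ 2) ≤
            θ ^ (-(1 : ℝ) / 2) *
                (∫ x, h.gradSq u x ∂(riemannianMeasure (h.toContMDiffRiemannianMetric hh))) + ε) :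
    sharpLogSobolevAVR_four := by
  intro P _ _ _ _ _ _ _ _ _ h _ hh θ hcpt hRic hθ havr u hu hcu h1 τ hτ
  exact logSobolev_scaleForm_of_rearrangement hθ (H P h hh θ hcpt hRic hθ havr u hu hcu h1) hτ


/-- **The real-variable heart of §3.1, Lipschitz version (no slack).** If `θ > 0` and there is ONE
compactly supported Lipschitz `v : ℝ⁴ → ℝ` with `∫ v² dx = 1`, entropy `≥ E` and Euclidean energy
`∫ ‖Dv‖² dx ≤ θ^{-1/2} G` (`Dv` the a.e. Fréchet derivative) — as the rearrangement `û ∘ |·|` of a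
normalised test function with entropy `E` and energy `G` is, by the displays of §3.1 and the
Pólya–Szegő inequality (2.4) of the paper — then `E ≤ 4τG − log θ − 2 log(4πτ) − 4` for every `τ > 0`
(`euclideanLogSobolev_scale_four_of_lipschitz` at the scale `σ = τ θ^{1/2}`).
[cite: BaloghKristalyTripaldi2024, §3.1 (p. 8) with (2.4), (2.5)] -/
theorem logSobolev_scaleForm_of_lipschitzRearrangement {E G θ : ℝ} (hθ : 0 < θ)
    (H : ∃ (v : EuclideanSpace ℝ (Fin 4) → ℝ) (K : ℝ≥0), LipschitzWith K v ∧ HasCompactSupport v ∧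
      (∫ x, v x ^ 2) = 1 ∧ E ≤ (∫ x, v x ^ 2 * Real.log (v x ^ 2)) ∧
      (∫ x, ‖fderiv ℝ v x‖ ^ 2) ≤ θ ^ (-(1 : ℝ) / 2) * G)
    {τ : ℝ} (hτ : 0 < τ) :
    E ≤ 4 * τ * G - Real.log θ - 2 * Real.log (4 * Real.pi * τ) - 4 := by
  obtain ⟨v, K, hv, hvs, hv1, hvE, hvG⟩ := H
  have hsq : 0 < Real.sqrt θ := Real.sqrt_pos.2 hθ
  obtain ⟨σ, hσ⟩ : ∃ σ : ℝ, σ = τ * Real.sqrt θ := ⟨_, rfl⟩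
  have hσpos : 0 < σ := hσ ▸ mul_pos hτ hsq
  have hLSI :=
    Literature.Analysis.FunctionSpaces.euclideanLogSobolev_scale_four_of_lipschitz hv hvs hv1 hσpos
  have hkey : σ * θ ^ (-(1 : ℝ) / 2) = τ := by
    rw [hσ, neg_div, Real.rpow_neg hθ.le, ← Real.sqrt_eq_rpow, mul_assoc, mul_inv_cancel₀ hsq.ne',
      mul_one]
  have hlog : Real.log (4 * Real.pi * σ) = Real.log (4 * Real.pi * τ) + Real.log θ / 2 := by
    rw [hσ, ← mul_assoc, Real.log_mul (by positivity) hsq.ne', Real.log_sqrt hθ.le]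
  have h6 : 4 * σ * (∫ x, ‖fderiv ℝ v x‖ ^ 2) ≤ 4 * σ * (θ ^ (-(1 : ℝ) / 2) * G) :=
    mul_le_mul_of_nonneg_left hvG (by positivity)
  have h7 := hLSI.trans (sub_le_sub_right (sub_le_sub_right h6 (2 * Real.log (4 * Real.pi * σ))) 4)
  have h8 : 4 * σ * (θ ^ (-(1 : ℝ) / 2) * G) = 4 * τ * G := by
    calc 4 * σ * (θ ^ (-(1 : ℝ) / 2) * G) = 4 * (σ * θ ^ (-(1 : ℝ) / 2)) * G := by ring
      _ = 4 * τ * G := by rw [hkey]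
  rw [h8, hlog] at h7
  have h9 := hvE.trans h7
  linarith

/-- **§3.1 of Balogh–Kristály–Tripaldi 2024 with a Lipschitz rearrangement.** If on the data of the
fact every smooth compactly supported `u` with `∫ u² dV_h = 1` has a compactly supported Lipschitz
`v : ℝ⁴ → ℝ` with `∫ v² dx = 1`, `∫ u² log u² dV_h ≤ ∫ v² log v² dx` and
`∫ ‖Dv‖² dx ≤ θ^{-1/2} ∫ |∇u|²_h dV_h` — literally what the paper's §3.1 establishes for
`v = û ∘ |·|` (invariance of norm and entropy under rearrangement; the Pólya–Szegő inequality (2.4)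
of Nobili–Violo from the sharp isoperimetric inequality and the coarea formula) — then
`sharpLogSobolevAVR_four` holds, the model inequality (2.5) in the Lipschitz class being the proved
`euclideanLogSobolev_scale_four_of_lipschitz`. [cite: BaloghKristalyTripaldi2024, §3.1 (p. 8), (2.4), (2.5)] -/
theorem sharpLogSobolevAVR_four_of_lipschitzRearrangement
    (H : ∀ (P : Type) [TopologicalSpace P] [T2Space P] [SecondCountableTopology P]
      [ChartedSpace (EuclideanSpace ℝ (Fin 4)) P] [IsManifold (𝓡 4) ∞ P] [ConnectedSpace P]
      [T3Space P] [MeasurableSpace P] [BorelSpace P]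
      (h : PseudoRiemannianMetric (𝓡 4) ∞ (EuclideanSpace ℝ (Fin 4)) (TangentSpace (𝓡 4) : P → Type _))
      [h.HasLeviCivita] (hh : h.IsRiemannian) (θ : ℝ),
      (∀ (x : P) (r : NNReal), IsCompact {y : P | h.edist hh x y ≤ r}) →
      (∀ (x : P) (X : TangentSpace (𝓡 4) x), 0 ≤ h.ricci x X X) → 0 < θ →
      (∀ x : P, Tendsto (fun r : ℝ ↦
        ((riemannianMeasure (h.toContMDiffRiemannianMetric hh))
          {y : P | h.edist hh x y ≤ ENNReal.ofReal r}).toReal / (Real.pi ^ 2 / 2 * r ^ 4))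
        atTop (𝓝 θ)) →
      ∀ u : P → ℝ, ContMDiff (𝓡 4) 𝓘(ℝ, ℝ) ∞ u → HasCompactSupport u →
        ∫ x, (u x) ^ 2 ∂(riemannianMeasure (h.toContMDiffRiemannianMetric hh)) = 1 →
        ∃ (v : EuclideanSpace ℝ (Fin 4) → ℝ) (K : ℝ≥0), LipschitzWith K v ∧ HasCompactSupport v ∧
          (∫ x, v x ^ 2) = 1 ∧
          (∫ x, (u x) ^ 2 * Real.log ((u x) ^ 2) ∂(riemannianMeasure (h.toContMDiffRiemannianMetric hh))) ≤
            (∫ x, v x ^ 2 * Real.log (v x ^ 2)) ∧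
          (∫ x, ‖fderiv ℝ v x‖ ^ 2) ≤
            θ ^ (-(1 : ℝ) / 2) *
                (∫ x, h.gradSq u x ∂(riemannianMeasure (h.toContMDiffRiemannianMetric hh)))) :
    sharpLogSobolevAVR_four := by
  intro P _ _ _ _ _ _ _ _ _ h _ hh θ hcpt hRic hθ havr u hu hcu h1 τ hτ
  exact logSobolev_scaleForm_of_lipschitzRearrangement hθ (H P h hh θ hcpt hRic hθ havr u hu hcu h1) hτ

/-! ### The fact from the Pólya–Szegő inequality for the symmetric decreasing rearrangement -/

/-- **`sharpLogSobolevAVR_four` from the Pólya–Szegő inequality alone.** On the data of the fact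
let `μ = dV_h` and, for a smooth compactly supported `u` with `∫ u² dμ = 1`, let
`u♯ = symmDecRearr 4 μ |u| : ℝ⁴ → ℝ` be the symmetric decreasing rearrangement of `|u|` onto `ℝ⁴`
(`Literature.Analysis.FunctionSpaces.symmDecRearr`; the paper's `û` read radially, (2.3)). IF `u♯`
is Lipschitz and satisfies the **Pólya–Szegő inequality** (2.4) with `p = 2`, `N = 4`,
`∫ ‖Du♯‖² dx ≤ AVR^{-1/2} ∫ |∇u|²_h dV_h` (Nobili–Violo; from the sharp isoperimetric inequality of
`CD(0,4)` spaces with Euclidean volume growth and the coarea formula — pillars (a) and (c) of the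
printed proof, NOT in the tree), THEN the fact holds: `u♯` has compact support, the same `L²` norm
and the same entropy as `u` (`hasCompactSupport_symmDecRearr`, `integral_symmDecRearr_sq`,
`integral_symmDecRearr_sq_mul_log` — the two displays of §3.1, PROVED), and
`sharpLogSobolevAVR_four_of_lipschitzRearrangement` applies with `v = u♯` (the model inequality (2.5)
being the proved `euclideanLogSobolev_scale_four_of_lipschitz`). This theorem is therefore the exact
residual content of Thm. 1.1 (`p = 2`, `N = 4`) relative to the tree.
[cite: BaloghKristalyTripaldi2024, §3.1 (p. 8), (2.3), (2.4)] -/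
theorem sharpLogSobolevAVR_four_of_polyaSzego
    (H : ∀ (P : Type) [TopologicalSpace P] [T2Space P] [SecondCountableTopology P]
      [ChartedSpace (EuclideanSpace ℝ (Fin 4)) P] [IsManifold (𝓡 4) ∞ P] [ConnectedSpace P]
      [T3Space P] [MeasurableSpace P] [BorelSpace P]
      (h : PseudoRiemannianMetric (𝓡 4) ∞ (EuclideanSpace ℝ (Fin 4)) (TangentSpace (𝓡 4) : P → Type _))
      [h.HasLeviCivita] (hh : h.IsRiemannian) (θ : ℝ),
      (∀ (x : P) (r : NNReal), IsCompact {y : P | h.edist hh x y ≤ r}) →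
      (∀ (x : P) (X : TangentSpace (𝓡 4) x), 0 ≤ h.ricci x X X) → 0 < θ →
      (∀ x : P, Tendsto (fun r : ℝ ↦
        ((riemannianMeasure (h.toContMDiffRiemannianMetric hh))
          {y : P | h.edist hh x y ≤ ENNReal.ofReal r}).toReal / (Real.pi ^ 2 / 2 * r ^ 4))
        atTop (𝓝 θ)) →
      ∀ u : P → ℝ, ContMDiff (𝓡 4) 𝓘(ℝ, ℝ) ∞ u → HasCompactSupport u →
        ∫ x, (u x) ^ 2 ∂(riemannianMeasure (h.toContMDiffRiemannianMetric hh)) = 1 →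
        ∃ K : ℝ≥0,
          LipschitzWith K (Literature.Analysis.FunctionSpaces.symmDecRearr 4
            (riemannianMeasure (h.toContMDiffRiemannianMetric hh)) fun a ↦ |u a|) ∧
          (∫ x, ‖fderiv ℝ (Literature.Analysis.FunctionSpaces.symmDecRearr 4
              (riemannianMeasure (h.toContMDiffRiemannianMetric hh)) fun a ↦ |u a|) x‖ ^ 2) ≤
            θ ^ (-(1 : ℝ) / 2) *
              (∫ x, h.gradSq u x ∂(riemannianMeasure (h.toContMDiffRiemannianMetric hh)))) :
    sharpLogSobolevAVR_four := by
  intro P _ _ _ _ _ _ _ _ _ h _ hh θ hcpt hRic hθ havr u hu hcu h1 τ hτ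
  set μ : Measure P := riemannianMeasure (h.toContMDiffRiemannianMetric hh) with hμ
  obtain ⟨K, hK, hPS⟩ := H P h hh θ hcpt hRic hθ havr u hu hcu h1
  set v := Literature.Analysis.FunctionSpaces.symmDecRearr 4 μ fun a ↦ |u a| with hv
  -- the hypotheses of the rearrangement API for `|u|`
  have huc : Continuous u := hu.continuous
  have hum : Measurable fun a ↦ |u a| := huc.abs.measurable
  have hu0 : ∀ a, 0 ≤ |u a| := fun a ↦ abs_nonneg _
  obtain ⟨M, hMb⟩ : ∃ M : ℝ, ∀ a, |u a| ≤ M := by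
    obtain ⟨M, hM⟩ := huc.bounded_above_of_compact_support hcu
    exact ⟨M, fun a ↦ by simpa only [Real.norm_eq_abs] using hM a⟩
  have hM : μ {a | M < |u a|} = 0 := by
    have : {a | M < |u a|} = ∅ := eq_empty_of_forall_notMem fun a ha ↦ (not_lt.2 (hMb a)) ha
    rw [this, measure_empty]
  have hfin : μ {a | 0 < |u a|} ≠ ⊤ := by
    have hsub : {a | 0 < |u a|} ⊆ tsupport u := fun a ha ↦
      subset_tsupport u (mem_support.2 (abs_pos.1 ha))
    exact (lt_of_le_of_lt (measure_mono hsub)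
      (riemannianVolume_lt_top_of_isCompact_holds _ le_rfl hcu)).ne
  have four_ne : (4 : ℕ) ≠ 0 := by norm_num
  have hvs : HasCompactSupport v :=
    Literature.Analysis.FunctionSpaces.hasCompactSupport_symmDecRearr four_ne hM hfin
  have hv1 : (∫ x, v x ^ 2) = 1 := by
    rw [hv, Literature.Analysis.FunctionSpaces.integral_symmDecRearr_sq four_ne hum hu0 hM hfin]
    simp_rw [sq_abs]
    exact h1
  have hvE : (∫ x, (u x) ^ 2 * Real.log ((u x) ^ 2) ∂μ) ≤ (∫ x, v x ^ 2 * Real.log (v x ^ 2)) := by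
    rw [hv, Literature.Analysis.FunctionSpaces.integral_symmDecRearr_sq_mul_log four_ne hum hu0 hM
      hfin]
    simp_rw [sq_abs]
    rfl
  exact logSobolev_scaleForm_of_lipschitzRearrangement hθ ⟨v, K, hK, hvs, hv1, hvE, hPS⟩ hτ

/-! ### The fact from the Pólya–Szegő inequality in Sobolev form (Nobili–Violo, as printed) -/

/-- **The real-variable core of §3.1, abstract form.** If `E ≤ E'` (entropy does not decrease
under rearrangement), `E' ≤ 4σD − 2 log(4πσ) − 4` for every `σ > 0` (the model log-Sobolev
inequality for the rearranged function, energy `D`), and `D ≤ θ^{-1/2} G` (Pólya–Szegő), then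
`E ≤ 4τG − log θ − 2 log(4πτ) − 4` for every `τ > 0` (take `σ = τ θ^{1/2}`).
[cite: BaloghKristalyTripaldi2024, §3.1 (p. 8)] -/
theorem logSobolev_scaleForm_of_modelInequality {E E' D G θ : ℝ} (hθ : 0 < θ) (hE : E ≤ E')
    (hLSI : ∀ σ : ℝ, 0 < σ → E' ≤ 4 * σ * D - 2 * Real.log (4 * Real.pi * σ) - 4)
    (hD : D ≤ θ ^ (-(1 : ℝ) / 2) * G) {τ : ℝ} (hτ : 0 < τ) :
    E ≤ 4 * τ * G - Real.log θ - 2 * Real.log (4 * Real.pi * τ) - 4 := by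
  have hsq : 0 < Real.sqrt θ := Real.sqrt_pos.2 hθ
  obtain ⟨σ, hσ⟩ : ∃ σ : ℝ, σ = τ * Real.sqrt θ := ⟨_, rfl⟩
  have hσpos : 0 < σ := hσ ▸ mul_pos hτ hsq
  have hkey : σ * θ ^ (-(1 : ℝ) / 2) = τ := by
    rw [hσ, neg_div, Real.rpow_neg hθ.le, ← Real.sqrt_eq_rpow, mul_assoc, mul_inv_cancel₀ hsq.ne',
      mul_one]
  have hlog : Real.log (4 * Real.pi * σ) = Real.log (4 * Real.pi * τ) + Real.log θ / 2 := by
    rw [hσ, ← mul_assoc, Real.log_mul (by positivity) hsq.ne', Real.log_sqrt hθ.le]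
  have h6 : 4 * σ * D ≤ 4 * σ * (θ ^ (-(1 : ℝ) / 2) * G) := mul_le_mul_of_nonneg_left hD (by positivity)
  have h8 : 4 * σ * (θ ^ (-(1 : ℝ) / 2) * G) = 4 * τ * G := by
    calc 4 * σ * (θ ^ (-(1 : ℝ) / 2) * G) = 4 * (σ * θ ^ (-(1 : ℝ) / 2)) * G := by ring
      _ = 4 * τ * G := by rw [hkey]
  have h7 := hLSI σ hσpos
  rw [hlog] at h7
  linarith

/-- **`sharpLogSobolevAVR_four` from the Pólya–Szegő inequality as Nobili–Violo print it.** On the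
data of the fact let `μ = dV_h` and, for a smooth compactly supported `u` with `∫ u² dμ = 1`, let
`u♯ = symmDecRearr 4 μ |u| : ℝ⁴ → ℝ` (the Euclidean monotone rearrangement of `|u|` read radially).
IF `u♯ ∈ W^{1,2}(ℝ⁴)` (`MemSobolevDomain 1 2 ⊤ volume u♯`, weak derivatives `HasWeakFDerivOn`) and
every weak gradient `g` of `u♯` satisfies `∫ ‖g‖² dx ≤ θ^{-1/2} ∫ |∇u|²_h dμ` — which is
Nobili–Violo 2024, Prop. 3.3 ("`∫ |∇u|² dm ≥ AVR^{2/N} ∫₀^∞ |∇u*|² dm_N`, meaning that, if the left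
hand side is finite, then `u* ∈ W^{1,2}_loc(I_N)`"), `N = 4`, applied to `|u|`, with `|∇|u|| ≤ |∇u|`
(Balogh–Kristály–Tripaldi 2024, §3.1, first sentence), i.e. pillars (a) isoperimetry + (c) coarea of
the printed proof, NOT in the tree — THEN the fact holds: `u♯` is bounded with compact support and has
the `L²` norm and entropy of `u` (`SymmetricDecreasingRearrangement.lean`, proved), the model
inequality in the class `W^{1,2}` is the proved `euclideanLogSobolev_scale_four_of_hasWeakFDerivOn`,
and `logSobolev_scaleForm_of_modelInequality` assembles §3.1. With this theorem the residual content
of Thm. 1.1 (`p = 2`, `N = 4`) relative to the tree is exactly the displayed hypothesis.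
[cite: BaloghKristalyTripaldi2024, §3.1 (p. 8), (2.3), (2.4)] [cite: NobiliViolo2024, §3.1 Prop. 3.3] -/
theorem sharpLogSobolevAVR_four_of_sobolevRearrangement
    (H : ∀ (P : Type) [TopologicalSpace P] [T2Space P] [SecondCountableTopology P]
      [ChartedSpace (EuclideanSpace ℝ (Fin 4)) P] [IsManifold (𝓡 4) ∞ P] [ConnectedSpace P]
      [T3Space P] [MeasurableSpace P] [BorelSpace P]
      (h : PseudoRiemannianMetric (𝓡 4) ∞ (EuclideanSpace ℝ (Fin 4)) (TangentSpace (𝓡 4) : P → Type _))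
      [h.HasLeviCivita] (hh : h.IsRiemannian) (θ : ℝ),
      (∀ (x : P) (r : NNReal), IsCompact {y : P | h.edist hh x y ≤ r}) →
      (∀ (x : P) (X : TangentSpace (𝓡 4) x), 0 ≤ h.ricci x X X) → 0 < θ →
      (∀ x : P, Tendsto (fun r : ℝ ↦
        ((riemannianMeasure (h.toContMDiffRiemannianMetric hh))
          {y : P | h.edist hh x y ≤ ENNReal.ofReal r}).toReal / (Real.pi ^ 2 / 2 * r ^ 4))
        atTop (𝓝 θ)) →
      ∀ u : P → ℝ, ContMDiff (𝓡 4) 𝓘(ℝ, ℝ) ∞ u → HasCompactSupport u →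
        ∫ x, (u x) ^ 2 ∂(riemannianMeasure (h.toContMDiffRiemannianMetric hh)) = 1 →
        Literature.Analysis.FunctionSpaces.MemSobolevDomain 1 2 ⊤ volume
            (Literature.Analysis.FunctionSpaces.symmDecRearr 4
              (riemannianMeasure (h.toContMDiffRiemannianMetric hh)) fun a ↦ |u a|) ∧
          ∀ g : EuclideanSpace ℝ (Fin 4) → EuclideanSpace ℝ (Fin 4) →L[ℝ] ℝ,
            Literature.Analysis.FunctionSpaces.HasWeakFDerivOn ⊤ volume
                (Literature.Analysis.FunctionSpaces.symmDecRearr 4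
                  (riemannianMeasure (h.toContMDiffRiemannianMetric hh)) fun a ↦ |u a|) g →
              (∫ x, ‖g x‖ ^ 2) ≤
                θ ^ (-(1 : ℝ) / 2) *
                  (∫ x, h.gradSq u x ∂(riemannianMeasure (h.toContMDiffRiemannianMetric hh)))) :
    sharpLogSobolevAVR_four := by
  intro P _ _ _ _ _ _ _ _ _ h _ hh θ hcpt hRic hθ havr u hu hcu h1 τ hτ
  set μ : Measure P := riemannianMeasure (h.toContMDiffRiemannianMetric hh) with hμ
  obtain ⟨hmem, hEn⟩ := H P h hh θ hcpt hRic hθ havr u hu hcu h1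
  set v := Literature.Analysis.FunctionSpaces.symmDecRearr 4 μ fun a ↦ |u a| with hv
  -- a weak gradient with `‖g‖² ∈ L¹`
  obtain ⟨-, g, hg, hgcomp⟩ := Literature.Analysis.FunctionSpaces.memSobolevDomain_succ_iff.1 hmem
  have hgm : AEStronglyMeasurable g volume := by
    have h' := hg.locallyIntegrableOn_deriv
    rw [TopologicalSpace.Opens.coe_top, locallyIntegrableOn_univ] at h'
    exact LocallyIntegrable.aestronglyMeasurable h'
  have hG2 : Integrable (fun x ↦ ‖g x‖ ^ 2) volume := by
    refine Literature.Analysis.FunctionSpaces.integrable_norm_sq_of_memLp_apply hgm fun w ↦ ?_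
    have h' := hgcomp w
    rw [Literature.Analysis.FunctionSpaces.memSobolevDomain_zero_iff, TopologicalSpace.Opens.coe_top,
      Measure.restrict_univ] at h'
    exact h'
  -- the hypotheses of the rearrangement API for `|u|`
  have huc : Continuous u := hu.continuous
  have hum : Measurable fun a ↦ |u a| := huc.abs.measurable
  have hu0 : ∀ a, 0 ≤ |u a| := fun a ↦ abs_nonneg _
  obtain ⟨M, hMb⟩ : ∃ M : ℝ, ∀ a, |u a| ≤ M := by
    obtain ⟨M, hM⟩ := huc.bounded_above_of_compact_support hcu
    exact ⟨M, fun a ↦ by simpa only [Real.norm_eq_abs] using hM a⟩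
  have hM0 : 0 ≤ M := (abs_nonneg _).trans (hMb (Classical.arbitrary P))
  have hM : μ {a | M < |u a|} = 0 := by
    have : {a | M < |u a|} = ∅ := eq_empty_of_forall_notMem fun a ha ↦ (not_lt.2 (hMb a)) ha
    rw [this, measure_empty]
  have hfin : μ {a | 0 < |u a|} ≠ ⊤ := by
    have hsub : {a | 0 < |u a|} ⊆ tsupport u := fun a ha ↦
      subset_tsupport u (mem_support.2 (abs_pos.1 ha))
    exact (lt_of_le_of_lt (measure_mono hsub)
      (riemannianVolume_lt_top_of_isCompact_holds _ le_rfl hcu)).ne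
  have four_ne : (4 : ℕ) ≠ 0 := by norm_num
  have hvs : HasCompactSupport v :=
    Literature.Analysis.FunctionSpaces.hasCompactSupport_symmDecRearr four_ne hM hfin
  have hvB : ∀ x, |v x| ≤ M := fun x ↦ by
    rw [abs_of_nonneg (Literature.Analysis.FunctionSpaces.symmDecRearr_nonneg x)]
    exact Literature.Analysis.FunctionSpaces.symmDecRearr_le hM hM0 x
  have hv1 : (∫ x, v x ^ 2) = 1 := by
    rw [hv, Literature.Analysis.FunctionSpaces.integral_symmDecRearr_sq four_ne hum hu0 hM hfin]
    simp_rw [sq_abs]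
    exact h1
  have hvE : (∫ x, (u x) ^ 2 * Real.log ((u x) ^ 2) ∂μ) ≤ (∫ x, v x ^ 2 * Real.log (v x ^ 2)) := by
    rw [hv, Literature.Analysis.FunctionSpaces.integral_symmDecRearr_sq_mul_log four_ne hum hu0 hM
      hfin]
    simp_rw [sq_abs]
    rfl
  exact logSobolev_scaleForm_of_modelInequality hθ hvE
    (fun σ hσ ↦ Literature.Analysis.FunctionSpaces.euclideanLogSobolev_scale_four_of_hasWeakFDerivOn
      hg hvB hvs hG2 hv1 hσ) (hEn g hg) hτ

/-! ### §3.1 with APPROXIMATE Lipschitz rearrangements -/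

/-- **The real-variable heart of §3.1, approximate Lipschitz version.** Let `θ > 0` and let `E`,
`G` be two reals. Suppose that for every `ε > 0` there is a compactly supported Lipschitz
`v : ℝ⁴ → ℝ` with `|∫ v² dx − 1| ≤ ε`, entropy `∫ v² log v² dx ≥ E − ε` and Euclidean energy
`∫ ‖Dv‖² dx ≤ θ^{-1/2} G + ε`. Then `E ≤ 4τG − log θ − 2 log(4πτ) − 4` for every `τ > 0`: apply
the homogeneous Lipschitz log-Sobolev inequality
`euclideanLogSobolev_scale_homogeneous_four_of_lipschitz` at the scale `σ = τ θ^{1/2}` to `v_k`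
(`ε = 1/(k+1)`) and let `k → ∞` (`∫ v_k² → 1`, `a log a → 0`). This is the form of
Balogh–Kristály–Tripaldi's §3.1 that a DISCRETISED rearrangement feeds (no Sobolev regularity of
`u♯` needed). [cite: BaloghKristalyTripaldi2024, §3.1 (p. 8) with (2.4), (2.5)] -/
theorem logSobolev_scaleForm_of_approxLipschitzRearrangement {E G θ : ℝ} (hθ : 0 < θ)
    (H : ∀ ε : ℝ, 0 < ε → ∃ (v : EuclideanSpace ℝ (Fin 4) → ℝ) (K : ℝ≥0), LipschitzWith K v ∧
      HasCompactSupport v ∧ |(∫ x, v x ^ 2) - 1| ≤ ε ∧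
      E ≤ (∫ x, v x ^ 2 * Real.log (v x ^ 2)) + ε ∧
      (∫ x, ‖fderiv ℝ v x‖ ^ 2) ≤ θ ^ (-(1 : ℝ) / 2) * G + ε)
    {τ : ℝ} (hτ : 0 < τ) :
    E ≤ 4 * τ * G - Real.log θ - 2 * Real.log (4 * Real.pi * τ) - 4 := by
  have hsq : 0 < Real.sqrt θ := Real.sqrt_pos.2 hθ
  obtain ⟨σ, hσ⟩ : ∃ σ : ℝ, σ = τ * Real.sqrt θ := ⟨_, rfl⟩
  have hσpos : 0 < σ := hσ ▸ mul_pos hτ hsq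
  have hkey : σ * θ ^ (-(1 : ℝ) / 2) = τ := by
    rw [hσ, neg_div, Real.rpow_neg hθ.le, ← Real.sqrt_eq_rpow, mul_assoc, mul_inv_cancel₀ hsq.ne',
      mul_one]
  have hlog : Real.log (4 * Real.pi * σ) = Real.log (4 * Real.pi * τ) + Real.log θ / 2 := by
    rw [hσ, ← mul_assoc, Real.log_mul (by positivity) hsq.ne', Real.log_sqrt hθ.le]
  -- the sequence of approximate rearrangements
  set δ : ℕ → ℝ := fun k ↦ 1 / ((k : ℝ) + 1) with hδ
  have hδpos : ∀ k, 0 < δ k := fun k ↦ by positivity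
  have hδlim : Tendsto δ atTop (𝓝 0) := tendsto_one_div_add_atTop_nhds_zero_nat
  choose v K hv hvs hva hvE hvG using fun k ↦ H (δ k) (hδpos k)
  set a : ℕ → ℝ := fun k ↦ ∫ x, v k x ^ 2 with ha_def
  have ha : Tendsto a atTop (𝓝 1) := by
    have h1 : Tendsto (fun k ↦ a k - 1) atTop (𝓝 0) := by
      refine squeeze_zero_norm (fun k ↦ ?_) hδlim
      rw [Real.norm_eq_abs]
      exact hva k
    have h2 := h1.add_const 1
    simpa using h2
  -- eventually `a_k > 0`, and then the homogeneous inequality holds for `v_k`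
  have hev : ∀ᶠ k in atTop, 0 < a k := (tendsto_order.1 ha).1 0 one_pos
  obtain ⟨c, hc⟩ : ∃ c : ℝ, c = 4 + 2 * Real.log (4 * Real.pi * σ) := ⟨_, rfl⟩
  set R : ℕ → ℝ := fun k ↦
    δ k + a k * Real.log (a k) + 4 * σ * (θ ^ (-(1 : ℝ) / 2) * G + δ k) - a k * c with hR
  have hineq : ∀ᶠ k in atTop, E ≤ R k := by
    filter_upwards [hev] with k hk
    have h := Literature.Analysis.FunctionSpaces.euclideanLogSobolev_scale_homogeneous_four_of_lipschitz
      (hv k) (hvs k) hk hσpos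
    rw [← hc] at h
    have h6 : 4 * σ * (∫ x, ‖fderiv ℝ (v k) x‖ ^ 2) ≤ 4 * σ * (θ ^ (-(1 : ℝ) / 2) * G + δ k) :=
      mul_le_mul_of_nonneg_left (hvG k) (by positivity)
    have h7 := hvE k
    simp only [hR]
    change E ≤ (∫ x, v k x ^ 2 * Real.log (v k x ^ 2)) + δ k at h7
    change (∫ x, v k x ^ 2 * Real.log (v k x ^ 2)) - a k * Real.log (a k) ≤
      4 * σ * (∫ x, ‖fderiv ℝ (v k) x‖ ^ 2) - a k * c at h
    linarith
  -- pass to the limit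
  have hlim : Tendsto R atTop
      (𝓝 (0 + 1 * Real.log 1 + 4 * σ * (θ ^ (-(1 : ℝ) / 2) * G + 0) - 1 * c)) :=
    ((hδlim.add (ha.mul (ha.log one_ne_zero))).add
      ((hδlim.const_add _).const_mul _)).sub (ha.mul_const c)
  have hfin := ge_of_tendsto hlim hineq
  rw [Real.log_one, mul_zero, add_zero, zero_add, add_zero, one_mul, hc] at hfin
  have h8 : 4 * σ * (θ ^ (-(1 : ℝ) / 2) * G) = 4 * τ * G := by
    calc 4 * σ * (θ ^ (-(1 : ℝ) / 2) * G) = 4 * (σ * θ ^ (-(1 : ℝ) / 2)) * G := by ring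
      _ = 4 * τ * G := by rw [hkey]
  rw [h8, hlog] at hfin
  linarith

/-- **§3.1 of Balogh–Kristály–Tripaldi 2024 with approximate Lipschitz rearrangements.** If on
the data of the fact every smooth compactly supported `u` with `∫ u² dV_h = 1` admits, for every
`ε > 0`, a compactly supported Lipschitz `v : ℝ⁴ → ℝ` with `|∫ v² dx − 1| ≤ ε`,
`∫ u² log u² dV_h ≤ ∫ v² log v² dx + ε` and `∫ ‖Dv‖² dx ≤ θ^{-1/2} ∫ |∇u|²_h dV_h + ε`, then
`sharpLogSobolevAVR_four` holds (`logSobolev_scaleForm_of_approxLipschitzRearrangement`). This is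
the entrance for a discretised Pólya–Szegő argument: `v` a radial function, piecewise a capacitor
potential between consecutive level radii of the rearrangement `u♯`, whose energy is controlled
by the isoperimetric inequality of the superlevel sets of `|u|`.
[cite: BaloghKristalyTripaldi2024, §3.1 (p. 8), (2.4), (2.5)] -/
theorem sharpLogSobolevAVR_four_of_approxLipschitzRearrangement
    (H : ∀ (P : Type) [TopologicalSpace P] [T2Space P] [SecondCountableTopology P]
      [ChartedSpace (EuclideanSpace ℝ (Fin 4)) P] [IsManifold (𝓡 4) ∞ P] [ConnectedSpace P]
      [T3Space P] [MeasurableSpace P] [BorelSpace P]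
      (h : PseudoRiemannianMetric (𝓡 4) ∞ (EuclideanSpace ℝ (Fin 4)) (TangentSpace (𝓡 4) : P → Type _))
      [h.HasLeviCivita] (hh : h.IsRiemannian) (θ : ℝ),
      (∀ (x : P) (r : NNReal), IsCompact {y : P | h.edist hh x y ≤ r}) →
      (∀ (x : P) (X : TangentSpace (𝓡 4) x), 0 ≤ h.ricci x X X) → 0 < θ →
      (∀ x : P, Tendsto (fun r : ℝ ↦
        ((riemannianMeasure (h.toContMDiffRiemannianMetric hh))
          {y : P | h.edist hh x y ≤ ENNReal.ofReal r}).toReal / (Real.pi ^ 2 / 2 * r ^ 4))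
        atTop (𝓝 θ)) →
      ∀ u : P → ℝ, ContMDiff (𝓡 4) 𝓘(ℝ, ℝ) ∞ u → HasCompactSupport u →
        ∫ x, (u x) ^ 2 ∂(riemannianMeasure (h.toContMDiffRiemannianMetric hh)) = 1 →
        ∀ ε : ℝ, 0 < ε → ∃ (v : EuclideanSpace ℝ (Fin 4) → ℝ) (K : ℝ≥0), LipschitzWith K v ∧
          HasCompactSupport v ∧ |(∫ x, v x ^ 2) - 1| ≤ ε ∧
          (∫ x, (u x) ^ 2 * Real.log ((u x) ^ 2) ∂(riemannianMeasure (h.toContMDiffRiemannianMetric hh))) ≤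
            (∫ x, v x ^ 2 * Real.log (v x ^ 2)) + ε ∧
          (∫ x, ‖fderiv ℝ v x‖ ^ 2) ≤
            θ ^ (-(1 : ℝ) / 2) *
                (∫ x, h.gradSq u x ∂(riemannianMeasure (h.toContMDiffRiemannianMetric hh))) + ε) :
    sharpLogSobolevAVR_four := by
  intro P _ _ _ _ _ _ _ _ _ h _ hh θ hcpt hRic hθ havr u hu hcu h1 τ hτ
  exact logSobolev_scaleForm_of_approxLipschitzRearrangement hθ
    (H P h hh θ hcpt hRic hθ havr u hu hcu h1) hτ

/-! ### The fact from the sharp isoperimetric inequality ALONE (Minkowski content form) -/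

section Isoperimetric

variable {P : Type} [TopologicalSpace P] [T2Space P] [SecondCountableTopology P]
  [ChartedSpace (EuclideanSpace ℝ (Fin 4)) P] [IsManifold (𝓡 4) ∞ P] [ConnectedSpace P]
  [T3Space P] [MeasurableSpace P] [BorelSpace P]
  (h : PseudoRiemannianMetric (𝓡 4) ∞ (EuclideanSpace ℝ (Fin 4)) (TangentSpace (𝓡 4) : P → Type _))

omit [T2Space P] [MeasurableSpace P] [BorelSpace P] in
/-- On a connected manifold every relatively compact set is bounded for the Riemannian distance
(the distance from a point is continuous and finite). [folklore] -/
theorem exists_subset_edist_le_of_isCompact_closure (hh : h.IsRiemannian) {Ω : Set P}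
    (hΩ : IsCompact (closure Ω)) :
    ∃ (x₀ : P) (r : NNReal), Ω ⊆ {y : P | h.edist hh x₀ y ≤ r} := by
  haveI : Nonempty P := ConnectedSpace.toNonempty
  obtain ⟨x₀⟩ := ‹Nonempty P›
  rcases (closure Ω).eq_empty_or_nonempty with hemp | hne
  · refine ⟨x₀, 0, ?_⟩
    have : Ω = ∅ := subset_eq_empty subset_closure hemp
    rw [this]
    exact empty_subset _
  · have hcont : Continuous fun y ↦ h.edist hh x₀ y :=
      (PseudoRiemannianMetric.continuous_edist hh).comp (Continuous.prodMk_right x₀)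
    obtain ⟨y₀, hy₀, hmax⟩ := hΩ.exists_isMaxOn hne hcont.continuousOn
    have hfin : h.edist hh x₀ y₀ ≠ ⊤ := PseudoRiemannianMetric.edist_ne_top hh x₀ y₀
    refine ⟨x₀, (h.edist hh x₀ y₀).toNNReal, fun y hy ↦ ?_⟩
    have := hmax (subset_closure hy)
    simp only [mem_setOf_eq] at this ⊢
    rwa [ENNReal.coe_toNNReal hfin]

/-- `8√2 π / c² = θ^{-1/2}` for the isoperimetric constant `c = 4 (π²/2)^{1/4} θ^{1/4}` of
`ℝ⁴`-volume-growth `θ`. [folklore] -/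
theorem polyaSzego_constant_eq {θ : ℝ} (hθ : 0 < θ) :
    8 * Real.sqrt 2 * Real.pi / (4 * (Real.pi ^ 2 / 2) ^ (1 / 4 : ℝ) * θ ^ (1 / 4 : ℝ)) ^ 2 =
      θ ^ (-(1 : ℝ) / 2) := by
  have hπ := Real.pi_pos
  have hs2 : 0 < Real.sqrt 2 := Real.sqrt_pos.2 two_pos
  have h1 : ((Real.pi ^ 2 / 2) ^ (1 / 4 : ℝ)) ^ 2 = Real.pi / Real.sqrt 2 := by
    rw [← Real.rpow_natCast, ← Real.rpow_mul (by positivity)]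
    norm_num
    rw [show (1 / 2 : ℝ) = (1 : ℝ) / 2 by norm_num, ← Real.sqrt_eq_rpow, Real.sqrt_div' _ zero_le_two,
      Real.sqrt_sq hπ.le]
  have h2 : (θ ^ (1 / 4 : ℝ)) ^ 2 = Real.sqrt θ := by
    rw [← Real.rpow_natCast, ← Real.rpow_mul hθ.le]
    norm_num
    rw [show (1 / 2 : ℝ) = (1 : ℝ) / 2 by norm_num, ← Real.sqrt_eq_rpow]
  have h3 : θ ^ (-(1 : ℝ) / 2) = (Real.sqrt θ)⁻¹ := by
    rw [neg_div, Real.rpow_neg hθ.le, ← Real.sqrt_eq_rpow]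
  have hsθ : 0 < Real.sqrt θ := Real.sqrt_pos.2 hθ
  rw [mul_pow, mul_pow, h1, h2, h3]
  field_simp
  rw [Real.sq_sqrt zero_le_two]
  ring

omit [T2Space P] [SecondCountableTopology P] in
/-- **The distribution function of `|u|` has no plateau.** For a continuous compactly supported `u`
with a zero `x₀` on a connected manifold (whose Riemannian measure charges open sets),
`t ↦ vol{|u| > t}` is strictly decreasing on `[0, |u(x_M)|]` for any point `x_M` (in the application
a maximum point of `|u|`): between two levels lies a nonempty open set (intermediate value theorem
on the connected manifold). [folklore] -/
theorem strictAntiOn_measure_lt_abs (hh : h.IsRiemannian) {u : P → ℝ} (hu : Continuous u)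
    (hcu : HasCompactSupport u) {x₀ : P} (xM : P) (hx₀ : u x₀ = 0) :
    StrictAntiOn (fun t ↦ (riemannianMeasure (h.toContMDiffRiemannianMetric hh)) {a | t < |u a|})
      (Icc 0 |u xM|) := by
  set μ : Measure P := riemannianMeasure (h.toContMDiffRiemannianMetric hh) with hμ
  haveI : μ.IsOpenPosMeasure := isOpenPosMeasure_riemannianMeasure _
  haveI : IsFiniteMeasureOnCompacts μ :=
    ⟨fun K hK ↦ riemannianVolume_lt_top_of_isCompact_holds _ le_rfl hK⟩
  have hwc : Continuous fun a ↦ |u a| := hu.abs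
  intro s hs t ht hst
  -- the open set `{s < |u| < t}` is nonempty and disjoint from `{t < |u|}`
  have hval : (s + t) / 2 ∈ range fun a ↦ |u a| := by
    refine intermediate_value_univ x₀ xM hwc ⟨?_, ?_⟩
    · rw [hx₀, abs_zero]; linarith [hs.1]
    · linarith [ht.2]
  obtain ⟨z, hz⟩ := hval
  have hopen : IsOpen {a | s < |u a| ∧ |u a| < t} :=
    (isOpen_lt continuous_const hwc).inter (isOpen_lt hwc continuous_const)
  have hne : ({a | s < |u a| ∧ |u a| < t} : Set P).Nonempty :=
    ⟨z, by simp only [mem_setOf_eq]; constructor <;> [skip; skip] <;> simp only [hz] <;> linarith⟩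
  have hposU : 0 < μ {a | s < |u a| ∧ |u a| < t} := hopen.measure_pos μ hne
  have hfin : μ {a | t < |u a|} ≠ ⊤ := by
    refine (lt_of_le_of_lt (measure_mono fun a (ha : t < |u a|) ↦ ?_)
      (hcu.isCompact.measure_lt_top (μ := μ))).ne
    exact subset_tsupport u (Function.mem_support.2 (abs_pos.1 (lt_of_le_of_lt ht.1 ha)))
  have hms : MeasurableSet {a | s < |u a| ∧ |u a| < t} :=
    (measurableSet_lt measurable_const hwc.measurable).inter
      (measurableSet_lt hwc.measurable measurable_const)
  have hdisj : Disjoint {a | t < |u a|} {a | s < |u a| ∧ |u a| < t} :=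
    disjoint_left.2 fun a (ha : t < |u a|) ha' ↦ absurd (ha.trans ha'.2) (lt_irrefl _)
  have hle : μ {a | t < |u a|} + μ {a | s < |u a| ∧ |u a| < t} ≤ μ {a | s < |u a|} := by
    rw [← measure_union hdisj hms]
    exact measure_mono (union_subset (fun a (ha : t < |u a|) ↦ hst.trans ha) fun a ha ↦ ha.1)
  show μ {a | t < |u a|} < μ {a | s < |u a|}
  exact lt_of_lt_of_le (ENNReal.lt_add_right hfin hposU.ne') hle

/-- **From the slab inequality to the level bound** (general measure spaces): if
`∫_{t₁}^{t₂} c μ{w > t}^{3/4} dt ≤ ∫_{t₁ < w < t₂} ρ dμ` (`lintegral` form) for some `0 ≤ t₁`, `t₂`,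
`ρ ≥ 0` integrable and `μ{w > 0} < ∞`, then `c μ{w ≥ t₂}^{3/4} (t₂ − t₁) ≤ ∫_{t₁ < w < t₂} ρ dμ`
(`μ{w > t} ≥ μ{w ≥ t₂}` for `t < t₂`). [folklore] -/
theorem levelBound_of_slab {X : Type*} [MeasurableSpace X] {μ : Measure X} {w ρ : X → ℝ}
    (hfin : μ {a | 0 < w a} ≠ ⊤) (hρ0 : ∀ a, 0 ≤ ρ a) (hρi : Integrable ρ μ) {c : ℝ} (hc : 0 ≤ c)
    {t₁ t₂ : ℝ} (ht₁ : 0 ≤ t₁)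
    (hslab : ∫⁻ t in Ioo t₁ t₂, ENNReal.ofReal (c * (μ {a | t < w a}).toReal ^ (3 / 4 : ℝ)) ≤
      ∫⁻ a in {a | t₁ < w a ∧ w a < t₂}, ENNReal.ofReal (ρ a) ∂μ) :
    c * (μ {a | t₂ ≤ w a}).toReal ^ (3 / 4 : ℝ) * (t₂ - t₁) ≤
      ∫ a in {a | t₁ < w a ∧ w a < t₂}, ρ a ∂μ := by
  have hfin' : ∀ {t : ℝ}, 0 ≤ t → μ {a | t < w a} ≠ ⊤ := fun ht ↦
    ne_top_of_le_ne_top hfin (measure_mono fun a (ha : _ < w a) ↦ lt_of_le_of_lt ht ha)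
  set m : ℝ := (μ {a | t₂ ≤ w a}).toReal with hm
  set L : ℝ := ∫ a in {a | t₁ < w a ∧ w a < t₂}, ρ a ∂μ with hL
  have hL0 : 0 ≤ L := integral_nonneg hρ0
  have hlow : ∀ t ∈ Ioo t₁ t₂, m ≤ (μ {a | t < w a}).toReal := by
    intro t ht
    have ht0 : 0 ≤ t := ht₁.trans ht.1.le
    exact ENNReal.toReal_mono (hfin' ht0) (measure_mono fun a (ha : t₂ ≤ w a) ↦
      lt_of_lt_of_le ht.2 ha)
  have hconst : ∫⁻ t in Ioo t₁ t₂, ENNReal.ofReal (c * m ^ (3 / 4 : ℝ)) ≤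
      ∫⁻ t in Ioo t₁ t₂, ENNReal.ofReal (c * (μ {a | t < w a}).toReal ^ (3 / 4 : ℝ)) :=
    setLIntegral_mono' measurableSet_Ioo fun t ht ↦ ENNReal.ofReal_le_ofReal
      (mul_le_mul_of_nonneg_left (Real.rpow_le_rpow ENNReal.toReal_nonneg (hlow t ht)
        (by norm_num)) hc)
  rw [setLIntegral_const, Real.volume_Ioo, ← ENNReal.ofReal_mul (by positivity)] at hconst
  have hrhs : ∫⁻ a in {a | t₁ < w a ∧ w a < t₂}, ENNReal.ofReal (ρ a) ∂μ = ENNReal.ofReal L := by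
    rw [hL, ofReal_integral_eq_lintegral_ofReal hρi.integrableOn (ae_of_all _ hρ0)]
  have h2 := (hconst.trans hslab).trans_eq hrhs
  exact (ENNReal.ofReal_le_ofReal_iff hL0).1 h2

/-- **`sharpLogSobolevAVR_four` from the level bound.** If on the data of the fact every smooth
compactly supported `u` satisfies, for all levels `0 ≤ t₁ < t₂`, the **level bound**
`4 (π²/2)^{1/4} θ^{1/4} · vol{|u| ≥ t₂}^{3/4} · (t₂ − t₁) ≤ ∫_{t₁ < |u| < t₂} |∇u|_h dV_h` — the common
consequence of the sharp isoperimetric inequality (`sharpLogSobolevAVR_four_of_isoperimetric`)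
and of the sharp `L¹`-Sobolev inequality (`sharpLogSobolevAVR_four_of_l1Sobolev`) — then the fact
holds: the level bound feeds the discretised Pólya–Szegő inequality
(`exists_lipschitz_discretePolyaSzego_four_of_levelBound`, pillar (c)), whose output feeds the
Lipschitz Euclidean log-Sobolev inequality (pillar (b)) through
`sharpLogSobolevAVR_four_of_approxLipschitzRearrangement`. This is §3.1 of
Balogh–Kristály–Tripaldi with the isoperimetric input isolated in its weakest used form.
[cite: BaloghKristalyTripaldi2024, §2.1 (2.3)–(2.4) and §3.1] -/
theorem sharpLogSobolevAVR_four_of_levelBound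
    (H : ∀ (P : Type) [TopologicalSpace P] [T2Space P] [SecondCountableTopology P]
      [ChartedSpace (EuclideanSpace ℝ (Fin 4)) P] [IsManifold (𝓡 4) ∞ P] [ConnectedSpace P]
      [T3Space P] [MeasurableSpace P] [BorelSpace P]
      (h : PseudoRiemannianMetric (𝓡 4) ∞ (EuclideanSpace ℝ (Fin 4)) (TangentSpace (𝓡 4) : P → Type _))
      [h.HasLeviCivita] (hh : h.IsRiemannian) (θ : ℝ),
      (∀ (x : P) (r : NNReal), IsCompact {y : P | h.edist hh x y ≤ r}) →
      (∀ (x : P) (X : TangentSpace (𝓡 4) x), 0 ≤ h.ricci x X X) → 0 < θ →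
      (∀ x : P, Tendsto (fun r : ℝ ↦
        ((riemannianMeasure (h.toContMDiffRiemannianMetric hh))
          {y : P | h.edist hh x y ≤ ENNReal.ofReal r}).toReal / (Real.pi ^ 2 / 2 * r ^ 4))
        atTop (𝓝 θ)) →
      ∀ u : P → ℝ, ContMDiff (𝓡 4) 𝓘(ℝ, ℝ) ∞ u → HasCompactSupport u →
        ∀ t₁ t₂ : ℝ, 0 ≤ t₁ → t₁ < t₂ →
          4 * (Real.pi ^ 2 / 2) ^ (1 / 4 : ℝ) * θ ^ (1 / 4 : ℝ) *
              ((riemannianMeasure (h.toContMDiffRiemannianMetric hh)) {x | t₂ ≤ |u x|}).toReal ^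
                (3 / 4 : ℝ) * (t₂ - t₁) ≤
            ∫ x in {x | t₁ < |u x| ∧ |u x| < t₂}, Real.sqrt (h.gradSq u x)
              ∂(riemannianMeasure (h.toContMDiffRiemannianMetric hh))) :
    sharpLogSobolevAVR_four := by
  refine sharpLogSobolevAVR_four_of_approxLipschitzRearrangement ?_
  intro P _ _ _ _ _ _ _ _ _ h _ hh θ hcpt hRic hθ havr u hu hcu h1 ε hε
  set μ : Measure P := riemannianMeasure (h.toContMDiffRiemannianMetric hh) with hμ
  haveI : μ.IsOpenPosMeasure := isOpenPosMeasure_riemannianMeasure _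
  haveI : IsFiniteMeasureOnCompacts μ :=
    ⟨fun K hK ↦ riemannianVolume_lt_top_of_isCompact_holds _ le_rfl hK⟩
  haveI : Nonempty P := ConnectedSpace.toNonempty
  have huc : Continuous u := hu.continuous
  -- the data `w = |u|`, `ρ = |∇u|`, `c`
  set w : P → ℝ := fun a ↦ |u a| with hw
  set ρ : P → ℝ := fun a ↦ Real.sqrt (h.gradSq u a) with hρ
  set c : ℝ := 4 * (Real.pi ^ 2 / 2) ^ (1 / 4 : ℝ) * θ ^ (1 / 4 : ℝ) with hc
  have hcpos : 0 < c := by positivity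
  have hwc : Continuous w := huc.abs
  have hwm : Measurable w := hwc.measurable
  have hw0 : ∀ a, 0 ≤ w a := fun a ↦ abs_nonneg _
  -- the maximum `M = max |u| > 0` and a zero of `u`
  obtain ⟨xM, hxM⟩ := hwc.exists_forall_ge_of_hasCompactSupport hcu.abs
  set M : ℝ := w xM with hM
  have hwM : ∀ a, w a ≤ M := hxM
  have hMpos : 0 < M := by
    by_contra hle
    have h0 : ∀ a, u a = 0 := fun a ↦ abs_eq_zero.1 (le_antisymm ((hwM a).trans (not_lt.1 hle)) (abs_nonneg _))
    have : ∫ x, u x ^ 2 ∂μ = 0 := by simp [h0]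
    rw [this] at h1
    exact zero_ne_one h1
  -- a zero of `u`: otherwise `P` would be compact, of finite volume, and `AVR = 0`
  obtain ⟨x₀, hx₀⟩ : ∃ x₀, u x₀ = 0 := by
    by_contra hne
    push Not at hne
    have hsupp : tsupport u = univ :=
      eq_univ_iff_forall.2 fun x ↦ subset_tsupport u (mem_support.2 (hne x))
    have hK : IsCompact (univ : Set P) := by rw [← hsupp]; exact hcu
    have hfinU : μ univ < ⊤ := riemannianVolume_lt_top_of_isCompact_holds _ le_rfl hK
    have hbound : ∀ᶠ r in atTop,
        (μ {y : P | h.edist hh xM y ≤ ENNReal.ofReal r}).toReal / (Real.pi ^ 2 / 2 * r ^ 4) ≤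
          (μ univ).toReal / (Real.pi ^ 2 / 2 * r ^ 4) := by
      filter_upwards [eventually_gt_atTop 0] with r hr
      exact div_le_div_of_nonneg_right
        (ENNReal.toReal_mono hfinU.ne (measure_mono (subset_univ _))) (by positivity)
    have hlim : Tendsto (fun r : ℝ ↦ (μ univ).toReal / (Real.pi ^ 2 / 2 * r ^ 4)) atTop (𝓝 0) :=
      tendsto_const_nhds.div_atTop ((tendsto_pow_atTop four_ne_zero).const_mul_atTop (by positivity))
    have hθle : θ ≤ 0 := le_of_tendsto_of_tendsto (havr xM) hlim hbound
    exact absurd hθle (not_le.2 hθ)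
  -- finiteness and positivity of `vol{|u| > 0}`
  have hfin : μ {a | 0 < w a} ≠ ⊤ := by
    refine (lt_of_le_of_lt (measure_mono fun a (ha : 0 < |u a|) ↦ ?_)
      (hcu.isCompact.measure_lt_top (μ := μ))).ne
    exact subset_tsupport u (Function.mem_support.2 (abs_pos.1 ha))
  have hpos : μ {a | 0 < w a} ≠ 0 := by
    have hopen : IsOpen {a | 0 < w a} := isOpen_lt continuous_const hwc
    exact (hopen.measure_pos μ ⟨xM, hMpos⟩).ne'
  have hstrict : StrictAntiOn (fun t ↦ μ {a | t < w a}) (Icc 0 M) :=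
    strictAntiOn_measure_lt_abs h hh huc hcu xM hx₀
  -- `ρ = |∇u|`: continuous, compactly supported, `ρ² = |∇u|²`
  have hgc : Continuous (h.gradSq u) := (contMDiff_gradSq h hu).continuous
  have hg0 : ∀ x, 0 ≤ h.gradSq u x := h.gradSq_nonneg hh u
  have hρc : Continuous ρ := Real.continuous_sqrt.comp hgc
  have hρm : Measurable ρ := hρc.measurable
  have hρ0 : ∀ a, 0 ≤ ρ a := fun a ↦ Real.sqrt_nonneg _
  have hρsq : ∀ a, ρ a ^ 2 = h.gradSq u a := fun a ↦ Real.sq_sqrt (hg0 a)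
  have hgsupp : HasCompactSupport (h.gradSq u) := by
    refine hcu.mono' fun x hx ↦ ?_
    by_contra hx'
    exact hx (gradSq_eq_zero_of_notMem_tsupport' h hx')
  have hρ2 : Integrable (fun a ↦ ρ a ^ 2) μ := by
    simp_rw [hρsq]
    exact hgc.integrable_of_hasCompactSupport hgsupp
  have hG : ∫ a, ρ a ^ 2 ∂μ = ∫ a, h.gradSq u a ∂μ := integral_congr_ae (ae_of_all _ hρsq)
  -- the level bound, from the hypothesis
  have hlevel : ∀ t₁ t₂ : ℝ, 0 ≤ t₁ → t₁ < t₂ →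
      c * (μ {a | t₂ ≤ w a}).toReal ^ (3 / 4 : ℝ) * (t₂ - t₁) ≤
        ∫ a in {a | t₁ < w a ∧ w a < t₂}, ρ a ∂μ := fun t₁ t₂ ht₁ h12 ↦
    H P h hh θ hcpt hRic hθ havr u hu hcu t₁ t₂ ht₁ h12
  -- the discretised Pólya–Szegő inequality
  obtain ⟨v, K, hK, hvs, hv1, hvE, hvG⟩ :=
    Literature.Analysis.FunctionSpaces.exists_lipschitz_discretePolyaSzego_four_of_levelBound hwm
      hw0 hMpos hwM hfin hpos hstrict hρm hρ0 hρ2 hcpos hlevel hε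
  refine ⟨v, K, hK, hvs, ?_, ?_, ?_⟩
  · have : ∫ a, w a ^ 2 ∂μ = 1 := by simp_rw [hw, sq_abs]; exact h1
    rwa [this] at hv1
  · have : (∫ a, w a ^ 2 * Real.log (w a ^ 2) ∂μ) = ∫ a, u a ^ 2 * Real.log (u a ^ 2) ∂μ := by
      simp_rw [hw, sq_abs]
    rwa [this] at hvE
  · rw [hG, hc, polyaSzego_constant_eq hθ] at hvG
    exact hvG

/-- **`sharpLogSobolevAVR_four` from the sharp isoperimetric inequality ALONE.** If on the data of
the fact (a connected four-manifold `P`, a complete smooth Riemannian `h` — closed distance balls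
compact —, `Ric_h ≥ 0`, asymptotic volume ratio `θ > 0`) every bounded Borel set `Ω` satisfies the
**sharp isoperimetric inequality for the Minkowski content**,
`4 (π²/2)^{1/4} θ^{1/4} vol(Ω)^{3/4} ≤ vol⁺(Ω) = liminf_{ε→0⁺} vol(Ω_ε ∖ Ω)/ε`,
`Ω_ε = {x | ∃ y ∈ Ω, d(x,y) < ε}` — which is Balogh–Kristály, Math. Ann. 385 (2023), **Thm. 1.1**
(`m⁺(Ω) ≥ N ω_N^{1/N} AVR^{1/N} m(Ω)^{(N−1)/N}` for bounded Borel `Ω` in a `CD(0,N)` space with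
Euclidean volume growth; a complete Riemannian `n`-manifold with `Ric ≥ 0` being `CD(0,n)` by
Sturm / Lott–Villani; `N = 4`, `ω_4 = π²/2`; on manifolds also Brendle, CPAM 2023, and
Agostiniani–Fogagnolo–Mazzieri), pillar (a) of Balogh–Kristály–Tripaldi's proof — THEN the fact
holds. The rest of the printed proof is supplied by PROVED results of the tree:
the slab inequality without coarea (`lintegral_isoperimetricProfile_le_lintegral_slab`), the
discretised Pólya–Szegő inequality (`exists_lipschitz_discretePolyaSzego_four`, pillar (c)), the
sharp Euclidean log-Sobolev inequality for Lipschitz functions (pillar (b)) and the real-variable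
passage `sharpLogSobolevAVR_four_of_approxLipschitzRearrangement`. With this theorem the residual
content of Thm. 1.1 (`p = 2`, `N = 4`) relative to the tree is exactly the displayed hypothesis.
[cite: BaloghKristalyTripaldi2024, §2.1 (2.1) and §3.1] [cite: BaloghKristaly2022, Thm. 1.1] -/
theorem sharpLogSobolevAVR_four_of_isoperimetric
    (H : ∀ (P : Type) [TopologicalSpace P] [T2Space P] [SecondCountableTopology P]
      [ChartedSpace (EuclideanSpace ℝ (Fin 4)) P] [IsManifold (𝓡 4) ∞ P] [ConnectedSpace P]
      [T3Space P] [MeasurableSpace P] [BorelSpace P]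
      (h : PseudoRiemannianMetric (𝓡 4) ∞ (EuclideanSpace ℝ (Fin 4)) (TangentSpace (𝓡 4) : P → Type _))
      [h.HasLeviCivita] (hh : h.IsRiemannian) (θ : ℝ),
      (∀ (x : P) (r : NNReal), IsCompact {y : P | h.edist hh x y ≤ r}) →
      (∀ (x : P) (X : TangentSpace (𝓡 4) x), 0 ≤ h.ricci x X X) → 0 < θ →
      (∀ x : P, Tendsto (fun r : ℝ ↦
        ((riemannianMeasure (h.toContMDiffRiemannianMetric hh))
          {y : P | h.edist hh x y ≤ ENNReal.ofReal r}).toReal / (Real.pi ^ 2 / 2 * r ^ 4))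
        atTop (𝓝 θ)) →
      ∀ Ω : Set P, MeasurableSet Ω → (∃ (x₀ : P) (r : NNReal), Ω ⊆ {y : P | h.edist hh x₀ y ≤ r}) →
        ENNReal.ofReal (4 * (Real.pi ^ 2 / 2) ^ (1 / 4 : ℝ) * θ ^ (1 / 4 : ℝ) *
            ((riemannianMeasure (h.toContMDiffRiemannianMetric hh)) Ω).toReal ^ (3 / 4 : ℝ)) ≤
          liminf (fun ε : ℝ ↦ (riemannianMeasure (h.toContMDiffRiemannianMetric hh))
            ({x | ∃ y ∈ Ω, h.edist hh x y < ENNReal.ofReal ε} \ Ω) / ENNReal.ofReal ε) (𝓝[>] 0)) :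
    sharpLogSobolevAVR_four := by
  refine sharpLogSobolevAVR_four_of_levelBound ?_
  intro P _ _ _ _ _ _ _ _ _ h _ hh θ hcpt hRic hθ havr u hu hcu t₁ t₂ ht₁ h12
  set μ : Measure P := riemannianMeasure (h.toContMDiffRiemannianMetric hh) with hμ
  haveI : IsFiniteMeasureOnCompacts μ :=
    ⟨fun K hK ↦ riemannianVolume_lt_top_of_isCompact_holds _ le_rfl hK⟩
  set c : ℝ := 4 * (Real.pi ^ 2 / 2) ^ (1 / 4 : ℝ) * θ ^ (1 / 4 : ℝ) with hc
  have hcpos : 0 < c := by positivity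
  have huc : Continuous u := hu.continuous
  -- `ρ = |∇u|` is integrable
  have hgc : Continuous (h.gradSq u) := (contMDiff_gradSq h hu).continuous
  have hρc : Continuous fun a ↦ Real.sqrt (h.gradSq u a) := Real.continuous_sqrt.comp hgc
  have hgsupp : HasCompactSupport (h.gradSq u) := by
    refine hcu.mono' fun x hx ↦ ?_
    by_contra hx'
    exact hx (gradSq_eq_zero_of_notMem_tsupport' h hx')
  have hρs : HasCompactSupport fun a ↦ Real.sqrt (h.gradSq u a) := by
    refine hgsupp.mono fun x hx ↦ ?_
    rw [Function.mem_support] at hx ⊢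
    intro h0
    apply hx
    rw [h0, Real.sqrt_zero]
  have hρi : Integrable (fun a ↦ Real.sqrt (h.gradSq u a)) μ :=
    hρc.integrable_of_hasCompactSupport hρs
  have hfin : μ {a | 0 < |u a|} ≠ ⊤ := by
    refine (lt_of_le_of_lt (measure_mono fun a (ha : 0 < |u a|) ↦ ?_)
      (hcu.isCompact.measure_lt_top (μ := μ))).ne
    exact subset_tsupport u (Function.mem_support.2 (abs_pos.1 ha))
  -- the slab inequality, from the isoperimetric hypothesis through `IsoperimetricSlabInequality`
  have hiso : ∀ Ω : Set P, MeasurableSet Ω → IsCompact (closure Ω) →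
      (fun V : ℝ≥0∞ ↦ ENNReal.ofReal (c * V.toReal ^ (3 / 4 : ℝ))) (μ Ω) ≤
        liminf (fun ε : ℝ ↦ μ ({x | ∃ y ∈ Ω, h.edist hh x y < ENNReal.ofReal ε} \ Ω) /
          ENNReal.ofReal ε) (𝓝[>] 0) := by
    intro Ω hΩm hΩc
    have := H P h hh θ hcpt hRic hθ havr Ω hΩm
      (exists_subset_edist_le_of_isCompact_closure h hh hΩc)
    simpa only [hc, mul_assoc] using this
  have hslab := lintegral_isoperimetricProfile_le_lintegral_slab h hh
    (fun V : ℝ≥0∞ ↦ ENNReal.ofReal (c * V.toReal ^ (3 / 4 : ℝ))) hiso hu hcu ht₁ h12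
  exact levelBound_of_slab hfin (fun a ↦ Real.sqrt_nonneg _) hρi hcpos.le ht₁ hslab

/-- **`sharpLogSobolevAVR_four` from the sharp `L¹`-Sobolev inequality ALONE.** If on the data of
the fact (a connected four-manifold `P`, a complete smooth Riemannian `h`, `Ric_h ≥ 0`, asymptotic
volume ratio `θ > 0`) every smooth compactly supported `φ` satisfies the **sharp `L¹`-Sobolev
inequality** `4 (π²/2)^{1/4} θ^{1/4} (∫ |φ|^{4/3} dV_h)^{3/4} ≤ ∫ |∇φ|_h dV_h` — Brendle, CPAM 76
(2023), **Thm. 1.1** (`∫_D |∇f| + ∫_{∂D} f ≥ n |Bⁿ|^{1/n} θ^{1/n} (∫_D f^{n/(n−1)})^{(n−1)/n}` for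
positive smooth `f` on a compact domain `D`, proved by the ABP method; for `φ ∈ C_c^∞` take
`D ⊃ supp φ`, `f = (φ² + δ²)^{1/2}` and `δ → 0⁺`; `n = 4`, `|B⁴| = π²/2`), equivalent to the sharp
isoperimetric inequality (Balogh–Kristály 2023, remark after (1.2)) — THEN the fact holds: the
Sobolev inequality on smooth truncations gives the level bound (`levelBound_of_l1Sobolev`, no
coarea formula, no Minkowski content), and `sharpLogSobolevAVR_four_of_levelBound` does the rest.
With this theorem the residual content of Balogh–Kristály–Tripaldi's Thm. 1.1 (`p = 2`, `N = 4`)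
relative to the tree is exactly Brendle's inequality for `C_c^∞` functions.
[cite: Brendle2022, Thm. 1.1] [cite: BaloghKristalyTripaldi2024, §2.1 and §3.1] -/
theorem sharpLogSobolevAVR_four_of_l1Sobolev
    (H : ∀ (P : Type) [TopologicalSpace P] [T2Space P] [SecondCountableTopology P]
      [ChartedSpace (EuclideanSpace ℝ (Fin 4)) P] [IsManifold (𝓡 4) ∞ P] [ConnectedSpace P]
      [T3Space P] [MeasurableSpace P] [BorelSpace P]
      (h : PseudoRiemannianMetric (𝓡 4) ∞ (EuclideanSpace ℝ (Fin 4)) (TangentSpace (𝓡 4) : P → Type _))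
      [h.HasLeviCivita] (hh : h.IsRiemannian) (θ : ℝ),
      (∀ (x : P) (r : NNReal), IsCompact {y : P | h.edist hh x y ≤ r}) →
      (∀ (x : P) (X : TangentSpace (𝓡 4) x), 0 ≤ h.ricci x X X) → 0 < θ →
      (∀ x : P, Tendsto (fun r : ℝ ↦
        ((riemannianMeasure (h.toContMDiffRiemannianMetric hh))
          {y : P | h.edist hh x y ≤ ENNReal.ofReal r}).toReal / (Real.pi ^ 2 / 2 * r ^ 4))
        atTop (𝓝 θ)) →
      ∀ φ : P → ℝ, ContMDiff (𝓡 4) 𝓘(ℝ, ℝ) ∞ φ → HasCompactSupport φ →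
        4 * (Real.pi ^ 2 / 2) ^ (1 / 4 : ℝ) * θ ^ (1 / 4 : ℝ) *
            (∫ x, |φ x| ^ (4 / 3 : ℝ) ∂(riemannianMeasure (h.toContMDiffRiemannianMetric hh))) ^
              (3 / 4 : ℝ) ≤
          ∫ x, Real.sqrt (h.gradSq φ x) ∂(riemannianMeasure (h.toContMDiffRiemannianMetric hh))) :
    sharpLogSobolevAVR_four := by
  refine sharpLogSobolevAVR_four_of_levelBound ?_
  intro P _ _ _ _ _ _ _ _ _ h _ hh θ hcpt hRic hθ havr u hu hcu t₁ t₂ ht₁ h12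
  have hq : (1 : ℝ) / (4 / 3 : ℝ) = 3 / 4 := by norm_num
  have hC : 0 ≤ 4 * (Real.pi ^ 2 / 2) ^ (1 / 4 : ℝ) * θ ^ (1 / 4 : ℝ) := by positivity
  have key := levelBound_of_l1Sobolev h hh (q := 4 / 3) hC (by norm_num)
    (fun φ hφ hφc ↦ by rw [hq]; exact H P h hh θ hcpt hRic hθ havr φ hφ hφc) hu hcu ht₁ h12
  rwa [hq] at key

end Isoperimetric

end Literature.Geometry.Riemannian

end
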